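import Summits.SmoothPoincare4.SmoothPoincare4.Theses.ConvexBisection
import Summits.SmoothPoincare4.SmoothPoincare4.Theorems.AcyclicBisectionExists.Negative.Sphere
import Summits.SmoothPoincare4.SmoothPoincare4.Theorems.AcyclicBisectionExists.Negative.Doubles
import Summits.SmoothPoincare4.SmoothPoincare4.Theorems.ConvexBisectionPlanarBisectionRigidityStubPlanarSeamTransfer
import Literature.Topology.FourManifolds.GluingProofs
import Summits.SmoothPoincare4.SmoothPoincare4.Theorems.ContractibleTwistedDoubleStandard.Negative.DoubleBisection
import Literature.Geometry.Symplectic.SteinBallContact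
import Literature.Geometry.Kaehler.ManifoldFormsPullback
import Literature.Topology.FourManifolds.RotationBody
import Literature.Geometry.Manifold.OpenEmbeddingCriterion
import Literature.Topology.FourManifolds.ClosedBallSmoothMaps

/-!
# Disproof of `PlanarBisectionRigidity` — standing adversary's work file (gen 3, v7.2 — SORRY-FREE)

Crux `Summit.SmoothPoincare4.SmoothPoincare4.Theses.ConvexBisection.PlanarBisectionRigidity`
(stmt-SmoothPoincare4-10511, route ConvexBisection, rank 5): *every homotopy 4-sphere `M` that is
a Stein bisection `M = e₁W₁ ∪ e₂W₂` along a common contact seam, with `(∂W₁, ξ₁)` PLANAR, is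
diffeomorphic to `S⁴`.*

v6 is a RECONSTRUCTION + EXTENSION: the gen-1 file (v1–v5, 48 kB, evidence
`run/gate/evidence/stmt-SmoothPoincare4-10511/*-Disproof.lean`) was never published to the tree and
is not readable from the gen-2 jail; its proved content is re-derived here on top of the sibling
cruxes' LANDED negative-side libraries (`Theorems/AcyclicBisectionExists/Negative/*`,
`Theorems/ContractibleTwistedDoubleStandard/Negative/*`), which did not exist at gen 1.

v7.2 (gen 3, 2026-08-16): GAP G1 CLOSED — `planarContactBoundary_steinBall :
PlanarContactBoundary steinStructureClosedBall` is PROVED (§5a, ~1000 lines: the disc open book of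
`S³` with Giroux form `⟪J₀ z, ·⟫|_{S³}`; first inhabitant of the tree's `OpenBook`/`Supports`/
`IsPlanar` interface), so §5 (non-vacuity at `S⁴`, tightness, `PlanarBisectionExists ⇐ SPC4`) is
now UNCONDITIONAL and this file has NO `sorry`.  §§1–4 and the open book are filed for landing as
`Theorems/PlanarBisectionRigidity/Negative/{LoadBearing, WithoutHomotopyEquiv, SphereContactForm,
SphereOpenBookTube, SphereOpenBookCore, SphereOpenBook, SphereNonVacuity}.lean` (gate pending).
§7: the `k = 4` layer is now anchored in print — Oba, *Stein fillings of homology 3-spheres and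
mapping class groups* (Geom. Dedicata 2016, arXiv:1407.5257) Thm 1.1 + proof: a Stein fillable
contact ℤHS³ supported by an open book with page `Σ_{0,4}` has a UNIQUE Stein filling, `D⁴` or
Mazur type (one 1-, one 2-handle), and any two positive factorisations of its monodromy agree up to
Hurwitz moves and total conjugation; hence EVERY planar-bisected homotopy 4-sphere with 4 binding
components is a twisted double `X ∪_ψ X̄` of ONE contractible `X ∈ {D⁴, Mazur type}` by an
automorphism `ψ` of the boundary open book (gen-2 census: `ψ` = the reflection twin), i.e. it has
a handle decomposition with one 1-handle, two 2-handles, one 3-handle, one 4-handle.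

## Findings (index; every `theorem` below is machine-checked unless marked NEAR-MISS = `sorry`)

* §1 KILL CRITERION. `of_smoothPoincare4 : SmoothPoincare4 → PBR` (the conclusion of the crux is
  the summit's); `not_iff_exotic`: `¬ PBR ↔` some smooth `M ≃ₕ S⁴` carries a planar Stein bisection
  and NO diffeomorphism to `S⁴`. So an unconditional refutation is an exotic 4-sphere (with extra
  structure): NO KILL IS POSSIBLE short of `¬ SPC4`. The standing adversary therefore maps the
  terrain: load-bearing hypotheses, refutable strengthenings, the smallest open instances.
* §2 THE ∃-HYPOTHESIS AS DATA. `Witness M` (sibling) + `Witness.Planar`; `HasPlanarSteinBisection`;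
  `planarBisectionRigidity_iff`. Junk exclusion specific to this crux: a planar Stein domain is
  NONEMPTY with nonempty boundary (`nonempty_of_planarContactBoundary`: an open book has `k ≥ 1`
  binding circles), and over a nonempty `M` both halves, both boundaries and the seam are nonempty
  (sibling `Witness` §2, maximum principle) — no degenerate bisection inhabits the hypothesis.
  `OpenBook` admits no junk either (cores of distinct tubes are disjoint or equal, pages are full
  preimages of a submersion with the polar normal form, `Supports` pins a genuine Giroux form for
  the genuine complex tangencies): planarity is a REAL restriction, see §3.
* §3 LOAD-BEARING ANALYSIS (drop one hypothesis at a time).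
  - planarity dropped = `WithoutPlanar` ("every common-contact Stein bisection of a homotopy
    sphere is standard"): `withoutPlanar_iff_smoothPoincare4 : SteinBisectionExists →
    (WithoutPlanar ↔ SmoothPoincare4)` — modulo the KNOWN support item 10509 (Baykur 2006 Thm 5.1)
    dropping planarity gives back the summit itself. Planarity is THE load-bearing restriction.
  - contact matching / Stein-ness / embedding conditions dropped: still implied by SPC4 (same
    conclusion), hence irrefutable; not load-bearing for a DISproof, only for a proof.
  - `M ≃ₕ S⁴` dropped = `WithoutHomotopyEquiv`: FALSE on paper (`S¹ × S³ = D(S¹ × D³)`, seam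
    `(S¹ × S², ξ_std)` planar with annulus pages, Etnyre 2004 §2). Lean:
    `withoutHomotopyEquiv_false_of : ExistsPlanarSteinDomainWithB₁ → ¬ WithoutHomotopyEquiv` —
    PROVED via the double `D(W)` (tree gluing), the fold retraction `D(W) → W` (`exists_retraction_of_isDouble`,
    new) and `H₁(S⁴; ℚ) = 0`; the hypothesis (a planar compact Stein domain with `b₁ > 0`, e.g. the
    tree's own Stein `S¹ × B³ = FourThickening (g = 1)` once its boundary open book is built) is the
    only non-constructible input: NO `OpenBook` INSTANCE EXISTS IN THE TREE (gap G1 below).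
  - planarity on `J₁` vs `J₂`: equivalent (`planarBisectionRigidity_iff_right`, `Witness.swap`).
* §4 RELATION TO THE SIBLING CRUXES. `of_withoutPlanar` (mono); `of_acyclicBisectionRigidity :
  PlanarImpliesAcyclic → AcyclicBisectionRigidity → PBR`, and by the sibling's Mayer–Vietoris
  package the cite-fact `PlanarImpliesAcyclic` (Etnyre 2004 Thm 4.1 + `Q ≡ 0` in a homology
  sphere) REDUCES to `PlanarImpliesConnectedQHSSeam` (connected halves, `b₁(Γ) = b₂(Γ) = 0`):
  `planarImpliesAcyclic_of_seam`. This is the exact fact a prover must vendor to merge the two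
  rigidity cruxes.
* §5 NON-VACUITY / TIGHTNESS AT `S⁴` (UNCONDITIONAL since v7.2). The FULL hypothesis of the
  crux holds at the round sphere: hemispheres = standard Stein balls (sibling
  `crux_hypotheses_at_sphere`) + `planarContactBoundary_steinBall` (§5a, G1 closed: the disc open
  book `B = {z₁ = 0}`, `π = z₁/‖z₁‖` on `S³ = ∂𝔻⁴` supports `ξ_std`; Etnyre 2006, Wendl 2020
  Fig. 5.1). `hasPlanarSteinBisection_sphere`, `…_of_diffeomorph`, `…_of_smoothPoincare4`, and
  `planarBisectionExists_of_smoothPoincare4 : SmoothPoincare4 → PlanarBisectionExists`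
  (support item 10512 ⇐ summit: it cannot fail without an exotic `S⁴` either).
* §6 REFUTED-ON-PAPER STRENGTHENINGS (recorded for provers; formal versions modulo explicit
  hypotheses where cheap). `SeamIsSphere`/`HalvesAreBalls` (planar bisection of a homotopy sphere
  ⇒ seam `S³`): FALSE — `S⁴ = D(C)` for the Akbulut–Mazur cork `C` with its PLANAR Stein structure
  (Karakurt–Oba–Ukida arXiv:1607.07661 Prop 2.3; Oba arXiv:1405.3751), seam `∂C` a Brieskorn-type
  ℤHS³ `≠ S³`. `HalvesDiffeomorphic`: open/unknown at `S⁴` (would follow from uniqueness of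
  ℚ-acyclic planar fillings, false in general: Oba's pairs). `withoutHomotopyEquiv` see §3.
* §7 WENDL NORMAL FORM, THE SMALLEST OPEN INSTANCES, AND (v7, NEW) THE `k = 4` LAYER REDUCED TO
  REFLECTION TWINS = CORK TWISTS OF `S⁴` along planar Mazur-type corks (exact reduction to an
  `F₂` problem + census with zero exceptions; `twin_identity`). Details in the §7 docblock.
  (Original v6 summary:)
  By Wendl (arXiv:0806.3193 Thm 1) both halves are planar Lefschetz fibrations over `D²` with the
  seam's planar page `P_k` (sphere with `k` holes) and monodromy `φ`; ℚ-acyclic ⇔ exactly `k − 1`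
  vanishing cycles whose hole-incidence vectors span `ℚ^{k-1}`. So
  `M = Σ(F, F') := X_F ∪_id X̄_{F'}` for two positive factorisations `F, F'` of ONE `φ ∈ Mod(P_k, ∂)`.
  Reformulations proved on paper in the docstrings of §7: (i) HANDLES: `Σ(F,F') ≅ S⁴ ⇔
  V(F,F') := X_F ∪ {2-handles along the F'-cycles, page framing +1} ≅ ♮^{k-1}(S² × D²)`
  (Laudenbach–Poénaru); (ii) SECTIONS: `Σ(F,F') ∖ (binding link)` fibres over `S²`, and `Σ(F,F')`
  is surgery on `k` disjoint square-0 SECTIONS of an achiral genus-0 Lefschetz fibration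
  `Z → S²` with `(k−1)` positive and `(k−1)` negative critical points,
  `Z ≅ (S²-bundle over S²) # (k−1)ℂℙ² # (k−1)ℂℙ²-bar`; equivalently surgery on a `(k−1)`-component
  link of square-0 spheres in `#^{k-1}(ℂℙ² # ℂℙ²-bar)`; (iii) STABLE STANDARDNESS: `Σ(F,F') #
  k·(S² × S²)` (or twisted bundles) is standard — consistent with Barriers/StableInvariantsBlind:
  no stable invariant can certify a counterexample. (iv) `k ≤ 3`: `Mod(P_k, ∂)` abelian, positive
  factorisations unique up to Hurwitz moves ⇒ `Σ = D(X_F)` with `X_F ∈ {B⁴}`-presentations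
  trivially Andrews–Curtis trivial ⇒ `S⁴`. FIRST OPEN LAYER: `k = 4` (page = 4-holed sphere,
  `Mod ≅ PB₃ × ℤ³`), where gen-1's census found 64 Hurwitz-inequivalent pairs with ℤHS seams `≠ S³`
  and all doubles AC-trivial; the twisted pairs `Σ(F,F')`, `F ≁ F'`, are undecided — they are the
  concrete frontier of this crux.
* §8 TARGETS (v7.2): the picked line's four stubs are all SHIELDED — formal
  `stub_contractibleHalfDouble_of_spc4_of_crux3546 : SPC4 → crux 3546 → THE LEVER` (verbatim stub
  signature; `isDouble_of_diffeomorph`); no stub kill is possible.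
* §9 WHY IT RESISTS (for the provers). Every sector with a classification is standard (seam `S³`:
  Eliashberg + Cerf; `F ∼ F'`: doubles of AC-trivial planar 2-handlebodies; lens/`L(p,1)` seams
  excluded by `|H₁(Γ)| = t²` non-cyclic). A counterexample needs two Hurwitz+conjugation-
  inequivalent ℚ-acyclic positive factorisations of one planar monodromy whose `V(F,F')` is not
  `♮(S² × D²)` — and certifying that is certifying an exotic `S⁴`: no invariant in print survives
  `# (S² × S²)` (iii) or sum with `ℂℙ²`, and gauge theory is blind on homotopy spheres
  (Barriers/GaugeInvariantsBlind). Conversely a PROOF must at least decide all `Σ(F,F')` at `k = 4`.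

Gaps named for planners: G1 — CLOSED (v7.2, §5a); G2 an `OpenBook` on `S¹ × S²` (annulus
pages) for the tree's Stein `S¹ × B³` (the §5a toolkit — tube embeddings via
`isSmoothEmbedding_of_leftInverse_of_isOpenMap`, `sphN` fibrations, pulled-back ambient Giroux
forms, `angleForm_normalize`, `pages_algebra`-style identities — is the template); G3 Wendl's
theorem and planar Lefschetz vocabulary (none in tree); G4 Etnyre 2004 Thm 4.1 as a cite fact in
the form `PlanarImpliesConnectedQHSSeam`.
-/

noncomputable section

-- the prescribed namespace `Summit.<P>.<Sub>.…` duplicates `SmoothPoincare4` (P = Sub)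
set_option linter.dupNamespace false

open scoped Manifold ContDiff Topology ContinuousMap RealInnerProductSpace
open Set Function CategoryTheory CategoryTheory.Limits
open Literature.Geometry.Symplectic Literature.AlgebraicTopology.SingularHomology
open Literature.Topology.FourManifolds Literature.Geometry.Kaehler

namespace Summit.SmoothPoincare4.SmoothPoincare4.Cruxes.PlanarBisectionRigidity.Disproof

open Summit.SmoothPoincare4.SmoothPoincare4.Theses.ConvexBisection
open Summit.SmoothPoincare4.SmoothPoincare4.Theorems.AcyclicBisectionExists.Negative
open Summit.SmoothPoincare4.SmoothPoincare4.Theorems.ContractibleTwistedDoubleStandard.Negative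

/-- Local notation: the model space `ℝ⁴`. -/
local notation "𝔼4" => EuclideanSpace ℝ (Fin 4)
/-- Local notation: the round 4-sphere. -/
local notation "𝕊⁴" => (Metric.sphere (0 : EuclideanSpace ℝ (Fin 5)) 1)
/-- Local notation: the closed unit 4-ball. -/
local notation "𝔻⁴" => (Metric.closedBall (0 : EuclideanSpace ℝ (Fin 4)) 1)

/-! ## §1–§2 The ∃-hypothesis as data; the crux unfolded; kill criterion -/

/-- **A witness is planar** when the contact boundary of its FIRST half is planar — the extra
conjunct `PlanarContactBoundary J₁` of the crux on top of the sibling crux's `Witness`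
(`Theorems/AcyclicBisectionExists/Negative/Witness.lean`). [folklore] -/
def Planar {M : Type} [TopologicalSpace M] [ChartedSpace 𝔼4 M] (B : Witness M) : Prop :=
  PlanarContactBoundary B.J₁

/-- **The ∃-hypothesis of the crux as a predicate on `M`**: `M` carries a Stein bisection along a
common contact seam whose first half has planar contact boundary. [folklore] -/
def HasPlanarSteinBisection (M : Type) [TopologicalSpace M] [ChartedSpace 𝔼4 M] : Prop :=
  ∃ B : Witness M, Planar B

/-- The crux, unfolded: `PBR ↔ ∀ M ≃ₕ S⁴, HasPlanarSteinBisection M → M ≅ S⁴`. [folklore] -/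
theorem planarBisectionRigidity_iff :
    PlanarBisectionRigidity ↔
      ∀ (M : Type) [TopologicalSpace M] [T2Space M] [SecondCountableTopology M]
        [ChartedSpace 𝔼4 M] [IsManifold (𝓡 4) ∞ M], M ≃ₕ 𝕊⁴ → HasPlanarSteinBisection M →
        Nonempty (M ≃ₘ⟮𝓡 4, 𝓡 4⟯ 𝕊⁴) := by
  constructor
  · intro h M _ _ _ _ _ f ⟨B, hB⟩
    exact h M f ⟨B.W₁, inferInstance, inferInstance, inferInstance, inferInstance, B.W₂, inferInstance,
      inferInstance, inferInstance, inferInstance, B.J₁, B.J₂, B.e₁, B.e₂, B.emb₁, B.emb₂, B.cover,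
      B.inter₁, B.inter₂, B.contact, hB⟩
  · intro h M _ _ _ _ _ f hyp
    obtain ⟨W₁, _, _, _, _, W₂, _, _, _, _, J₁, J₂, e₁, e₂, h1, h2, h3, h4, h5, h6, h7⟩ := hyp
    exact h M f ⟨⟨W₁, W₂, J₁, J₂, e₁, e₂, h1, h2, h3, h4, h5, h6⟩, h7⟩

/-- **The crux is implied by the summit**: its conclusion `Nonempty (M ≃ₘ S⁴)` is SPC4's, for the
same `M`. So `¬ PBR → ¬ SmoothPoincare4`: no refutation short of an exotic 4-sphere. [folklore] -/
theorem of_smoothPoincare4 (h : _root_.SmoothPoincare4) : PlanarBisectionRigidity := by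
  intro M _ _ _ _ _ e _
  exact h M ‹_› ‹_› e

/-- **KILL CRITERION**: a refutation of the crux refutes the smooth 4-dimensional Poincaré
conjecture. [folklore] -/
theorem not_smoothPoincare4_of_not (h : ¬ PlanarBisectionRigidity) : ¬ _root_.SmoothPoincare4 :=
  fun hs => h (of_smoothPoincare4 hs)

/-- **What a kill IS**: `¬ PBR` holds iff some smooth `M ≃ₕ S⁴` carries a planar Stein bisection
along a common contact seam and admits NO diffeomorphism to `S⁴` — an exotic 4-sphere with a
planar seam (equivalently, by Wendl, two positive factorisations of one planar monodromy glued to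
an exotic sphere, §7). [folklore] -/
theorem not_iff_exotic :
    ¬ PlanarBisectionRigidity ↔
      ∃ (M : Type) (_ : TopologicalSpace M) (_ : T2Space M) (_ : SecondCountableTopology M)
        (_ : ChartedSpace 𝔼4 M) (_ : IsManifold (𝓡 4) ∞ M),
        Nonempty (M ≃ₕ 𝕊⁴) ∧ HasPlanarSteinBisection M ∧ IsEmpty (M ≃ₘ⟮𝓡 4, 𝓡 4⟯ 𝕊⁴) := by
  rw [planarBisectionRigidity_iff]
  constructor
  · intro h
    simp only [not_forall] at h
    obtain ⟨M, _, _, _, _, _, e, hP, hM⟩ := h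
    exact ⟨M, ‹_›, ‹_›, ‹_›, ‹_›, ‹_›, ⟨e⟩, hP, not_nonempty_iff.1 hM⟩
  · rintro ⟨M, _, _, _, _, _, ⟨e⟩, hP, hM⟩ h
    exact not_nonempty_iff.2 hM (h M e hP)

/-! ### Junk exclusion specific to the planar conjunct -/

section Junk

variable {W : Type} [TopologicalSpace W] [ChartedSpace (EuclideanHalfSpace 4) W]
  [IsManifold (𝓡∂ 4) ∞ W] [CompactSpace W]

/-- **A planar Stein domain has a boundary point**: an open book has `k ≥ 1` binding circles
(`OpenBook.binding_nonempty`), which live on the boundary datum's carrier `≅ ∂W`. So the planar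
conjunct can never be satisfied by an empty or closed first half. [folklore] -/
theorem boundary_nonempty_of_planarContactBoundary (J : SteinStructure W)
    (h : PlanarContactBoundary J) : ((𝓡∂ 4).boundary W).Nonempty := by
  obtain ⟨b, ob, -, -⟩ := h
  obtain ⟨y, -⟩ := ob.binding_nonempty
  exact ⟨b.incl y, b.incl_mem_boundary y⟩

/-- A planar Stein domain is nonempty. [folklore] -/
theorem nonempty_of_planarContactBoundary (J : SteinStructure W) (h : PlanarContactBoundary J) :
    Nonempty W := by
  obtain ⟨x, -⟩ := boundary_nonempty_of_planarContactBoundary J h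
  exact ⟨x⟩

/-- **No junk inhabitant over the empty manifold**: unlike the bare ∃-body of the existence cruxes
(`hasAcyclicSteinBisection_of_isEmpty`), a PLANAR witness forces `M ≠ ∅`. [folklore] -/
theorem nonempty_of_hasPlanarSteinBisection {M : Type} [TopologicalSpace M] [ChartedSpace 𝔼4 M]
    (h : HasPlanarSteinBisection M) : Nonempty M := by
  obtain ⟨B, hB⟩ := h
  obtain ⟨w⟩ := nonempty_of_planarContactBoundary B.J₁ hB
  exact ⟨B.e₁ w⟩

/-- Over any `M` with a planar witness: both halves are nonempty, both boundaries are nonempty and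
the seam is nonempty (sibling `Witness` §2 + the previous lemma). In particular the one-piece
"bisection" `W₁ = M`, `W₂ = ∅` and the empty bisection are excluded by the statement itself.
[folklore] -/
theorem seam_nonempty_of_planar {M : Type} [TopologicalSpace M] [ChartedSpace 𝔼4 M]
    (B : Witness M) (hB : Planar B) :
    B.seam.Nonempty ∧ Nonempty B.W₁ ∧ Nonempty B.W₂ ∧
      ((𝓡∂ 4).boundary B.W₁).Nonempty ∧ ((𝓡∂ 4).boundary B.W₂).Nonempty := by
  haveI : Nonempty M := nonempty_of_hasPlanarSteinBisection ⟨B, hB⟩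
  exact ⟨B.seam_nonempty, B.halves_nonempty.1, B.halves_nonempty.2, B.boundaries_nonempty.1,
    B.boundaries_nonempty.2⟩

end Junk

/-! ## §3 Load-bearing analysis -/

/-- **The crux with the planarity conjunct DROPPED** ("SteinBisectionRigidity"): every homotopy
4-sphere with a Stein bisection along a common contact seam is `S⁴`. [folklore] -/
def WithoutPlanar : Prop :=
  ∀ (M : Type) [TopologicalSpace M] [T2Space M] [SecondCountableTopology M]
    [ChartedSpace 𝔼4 M] [IsManifold (𝓡 4) ∞ M], M ≃ₕ 𝕊⁴ → Nonempty (Witness M) →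
    Nonempty (M ≃ₘ⟮𝓡 4, 𝓡 4⟯ 𝕊⁴)

/-- The support item `SteinBisectionExists` (stmt-10509; Baykur 2006 Thm 5.1, KNOWN) unfolded:
every homotopy 4-sphere has a witness. [folklore] -/
theorem steinBisectionExists_iff :
    SteinBisectionExists ↔
      ∀ (M : Type) [TopologicalSpace M] [T2Space M] [SecondCountableTopology M]
        [ChartedSpace 𝔼4 M] [IsManifold (𝓡 4) ∞ M], M ≃ₕ 𝕊⁴ → Nonempty (Witness M) := by
  constructor
  · intro h M _ _ _ _ _ f
    obtain ⟨W₁, _, _, _, _, W₂, _, _, _, _, J₁, J₂, e₁, e₂, h1, h2, h3, h4, h5, h6⟩ := h M f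
    exact ⟨⟨W₁, W₂, J₁, J₂, e₁, e₂, h1, h2, h3, h4, h5, h6⟩⟩
  · intro h M _ _ _ _ _ f
    obtain ⟨B⟩ := h M f
    exact ⟨B.W₁, inferInstance, inferInstance, inferInstance, inferInstance, B.W₂, inferInstance,
      inferInstance, inferInstance, inferInstance, B.J₁, B.J₂, B.e₁, B.e₂, B.emb₁, B.emb₂, B.cover,
      B.inter₁, B.inter₂, B.contact⟩

/-- `WithoutPlanar` is implied by the summit (same conclusion). [folklore] -/
theorem withoutPlanar_of_smoothPoincare4 (h : _root_.SmoothPoincare4) : WithoutPlanar := by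
  intro M _ _ _ _ _ e _
  exact h M ‹_› ‹_› e

/-- **Dropping planarity gives back the summit**: `WithoutPlanar ∧ SteinBisectionExists →
SmoothPoincare4` (every homotopy sphere HAS a witness, so rigidity for all witnesses is SPC4).
[folklore] -/
theorem smoothPoincare4_of_withoutPlanar (h : WithoutPlanar) (hE : SteinBisectionExists) :
    _root_.SmoothPoincare4 := by
  intro M _ _ _ _ _ e
  exact h M e ((steinBisectionExists_iff.1 hE) M e)

/-- **PLANARITY IS THE LOAD-BEARING RESTRICTION**: modulo the known support item
`SteinBisectionExists`, the crux without its planar conjunct is EQUIVALENT to the summit.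
[folklore] -/
theorem withoutPlanar_iff_smoothPoincare4 (hE : SteinBisectionExists) :
    WithoutPlanar ↔ _root_.SmoothPoincare4 :=
  ⟨fun h => smoothPoincare4_of_withoutPlanar h hE, withoutPlanar_of_smoothPoincare4⟩

/-- Monotonicity: `WithoutPlanar → PBR` (and `WithoutPlanar → AcyclicBisectionRigidity` likewise).
[folklore] -/
theorem of_withoutPlanar (h : WithoutPlanar) : PlanarBisectionRigidity := by
  rw [planarBisectionRigidity_iff]
  intro M _ _ _ _ _ e ⟨B, _hB⟩
  exact h M e ⟨B⟩

/-- **The crux with the homotopy-sphere hypothesis DROPPED**: every (Hausdorff, second countable)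
smooth 4-manifold with a planar Stein bisection along a common contact seam is `S⁴`. FALSE on
paper: `S¹ × S³ = D(S¹ × D³)`, both halves the Stein 1-handlebody `S¹ × D³ ⊂ ℂ²`, seam
`(S¹ × S², ξ_std)` supported by the annulus open book with trivial monodromy (planar).
[folklore] -/
def WithoutHomotopyEquiv : Prop :=
  ∀ (M : Type) [TopologicalSpace M] [T2Space M] [SecondCountableTopology M]
    [ChartedSpace 𝔼4 M] [IsManifold (𝓡 4) ∞ M], HasPlanarSteinBisection M →
    Nonempty (M ≃ₘ⟮𝓡 4, 𝓡 4⟯ 𝕊⁴)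

/-- The homotopy-sphere hypothesis only weakens: `WithoutHomotopyEquiv → PBR`. [folklore] -/
theorem of_withoutHomotopyEquiv (h : WithoutHomotopyEquiv) : PlanarBisectionRigidity := by
  rw [planarBisectionRigidity_iff]
  intro M _ _ _ _ _ _ hP
  exact h M hP

/-- **Hypothesis for the formal refutation of `WithoutHomotopyEquiv`: some planar compact Stein
domain has `H₁(W; ℚ) ≠ 0`.** TRUE on paper — `W = S¹ × D³` (the tree's own
`IsHoledDiscMorseFunction.FourThickening` in genus 1 with `exists_steinStructure_fourThickening`,
Gompf 1998 §2), whose boundary `(S¹ × S², ξ_std)` is planar (annulus open book; Etnyre 2004 §2) —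
but NOT constructible today: the tree has no `OpenBook` instance at all (gap G2), nor `b₁` of the
thickening. [cite: arXiv:math/0404267, §2] -/
def ExistsPlanarSteinDomainWithB₁ : Prop :=
  ∃ (W : Type) (_ : TopologicalSpace W) (_ : T2Space W) (_ : SecondCountableTopology W)
    (_ : ChartedSpace (EuclideanHalfSpace 4) W) (_ : IsManifold (𝓡∂ 4) ∞ W) (_ : CompactSpace W)
    (J : SteinStructure W), PlanarContactBoundary J ∧ ¬ IsZero (singularHomology ℚ ℚ W 1)

section Fold

variable {W : Type} [TopologicalSpace W] [ChartedSpace (EuclideanHalfSpace 4) W] [CompactSpace W]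
  {P : Type} [TopologicalSpace P] [ChartedSpace 𝔼4 P] [T2Space P]

/-- **The fold retraction of a double.** If `P = W ∪_id W` (`IsDouble`), there are a continuous
`j : W → P` (the first piece) and a continuous retraction `r : P → W`, `r ∘ j = id` (identity on
the first piece, the mirror on the second; well defined because the pieces meet exactly along
`∂W ≡_id ∂W`, continuous by pasting along the two closed pieces). [folklore] -/
theorem exists_retraction_of_isDouble (b : BoundaryData (𝓡∂ 4) W (𝓡 3)) (hD : IsDouble b (𝓡 4) P) :
    ∃ (j : C(W, P)) (r : C(P, W)), r.comp j = ContinuousMap.id W := by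
  obtain ⟨jA, jB, hA, hB, hU, hR⟩ := hD
  have hAe : Topology.IsEmbedding jA := hA.isEmbedding
  have hBe : Topology.IsEmbedding jB := hB.isEmbedding
  have hcA : IsClosed (range jA) := (isCompact_range hAe.continuous).isClosed
  have hcB : IsClosed (range jB) := (isCompact_range hBe.continuous).isClosed
  -- on the overlap the two inverses agree
  have hagree : ∀ a a', jA a = jB a' → a = a' := by
    intro a a' h
    obtain ⟨z, rfl, h'⟩ := (hR a a').1 h
    exact h'.symm
  have hmemB : ∀ p, p ∉ range jA → p ∈ range jB := fun p hp => by
    have : p ∈ range jA ∪ range jB := by rw [hU]; exact mem_univ p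
    exact this.resolve_left hp
  classical
  let r : P → W := fun p =>
    if h : p ∈ range jA then hAe.toHomeomorph.symm ⟨p, h⟩ else hBe.toHomeomorph.symm ⟨p, hmemB p h⟩
  have hrA : ∀ a, r (jA a) = a := fun a => by
    simp only [r, dif_pos (mem_range_self a)]
    exact hAe.toHomeomorph_symm_apply a
  have hrB : ∀ a, r (jB a) = a := fun a => by
    by_cases h : jB a ∈ range jA
    · obtain ⟨a₀, ha₀⟩ := h
      rw [← ha₀, hrA a₀]
      exact hagree a₀ a ha₀
    · simp only [r, dif_neg h]
      exact hBe.toHomeomorph_symm_apply a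
  have hcontA : ContinuousOn r (range jA) := by
    rw [continuousOn_iff_continuous_restrict]
    have : (range jA).restrict r = fun p => hAe.toHomeomorph.symm p := by
      funext q
      obtain ⟨p, a, rfl⟩ := q
      simp only [restrict_apply, hrA]
      exact (hAe.toHomeomorph_symm_apply a).symm
    rw [this]
    exact hAe.toHomeomorph.symm.continuous
  have hcontB : ContinuousOn r (range jB) := by
    rw [continuousOn_iff_continuous_restrict]
    have : (range jB).restrict r = fun p => hBe.toHomeomorph.symm p := by
      funext q
      obtain ⟨p, a, rfl⟩ := q
      simp only [restrict_apply, hrB]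
      exact (hBe.toHomeomorph_symm_apply a).symm
    rw [this]
    exact hBe.toHomeomorph.symm.continuous
  have hcont : Continuous r := by
    rw [← continuousOn_univ, ← hU]
    exact hcontA.union_of_isClosed hcontB hcA hcB
  exact ⟨⟨jA, hAe.continuous⟩, ⟨r, hcont⟩, ContinuousMap.ext hrA⟩

/-- **Homology of a piece injects into the homology of the double** (split by the fold): if
`Hₖ(P; ℚ) = 0` then `Hₖ(W; ℚ) = 0`. [folklore] -/
theorem isZero_homology_of_isDouble (b : BoundaryData (𝓡∂ 4) W (𝓡 3)) (hD : IsDouble b (𝓡 4) P)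
    {k : ℕ} (hP : IsZero (singularHomology ℚ ℚ P k)) : IsZero (singularHomology ℚ ℚ W k) := by
  obtain ⟨j, r, hrj⟩ := exists_retraction_of_isDouble b hD
  rw [IsZero.iff_id_eq_zero, ← singularHomology.map_id ℚ ℚ k, ← hrj, singularHomology.map_comp,
    hP.eq_of_tgt (singularHomology.map ℚ ℚ j k) 0, zero_comp]

end Fold

/-- **`M ≃ₕ S⁴` IS LOAD-BEARING (formal, modulo G2)**: if some planar compact Stein domain `W` has
`H₁(W; ℚ) ≠ 0`, the crux without its homotopy-sphere hypothesis is FALSE. Proof: the double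
`P = D(W)` exists (tree `exists_isBoundaryGluing_holds`, Bröcker–Jänich 13.11), is a planar
witness over itself (`Witness.ofIsDouble`, same `J` on both halves), so `WithoutHomotopyEquiv`
would give `P ≅ S⁴`, hence `H₁(P; ℚ) = 0`, hence `H₁(W; ℚ) = 0` by the fold retraction —
contradiction. Paper instance: `W = S¹ × D³`, `P = S¹ × S³`. [folklore] -/
theorem withoutHomotopyEquiv_false_of (h : ExistsPlanarSteinDomainWithB₁) : ¬ WithoutHomotopyEquiv := by
  intro hW
  obtain ⟨W, _, _, _, _, _, _, J, hJ, hH⟩ := h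
  obtain ⟨P, _, _, _, _, _, _, hP⟩ :=
    exists_isBoundaryGluing_holds (bM := BoundaryManifold.boundaryData 3 W)
      (bN := BoundaryManifold.boundaryData 3 W) (Diffeomorph.refl (𝓡 3) _ ∞)
  have hD : IsDouble (BoundaryManifold.boundaryData 3 W) (𝓡 4) P := by
    have e : (⇑(Diffeomorph.refl (𝓡 3) (BoundaryManifold.boundaryData 3 W).carrier ∞) :
        (BoundaryManifold.boundaryData 3 W).carrier → (BoundaryManifold.boundaryData 3 W).carrier) = id :=
      rfl
    rw [e] at hP
    exact hP
  have hPl : HasPlanarSteinBisection P :=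
    ⟨Witness.ofIsDouble (BoundaryManifold.boundaryData 3 W) J hD, hJ⟩
  obtain ⟨Φ⟩ := hW P hPl
  have e : P ≃ₕ 𝕊⁴ := Φ.toHomeomorph.toHomotopyEquiv
  have h1 : IsZero (singularHomology ℚ ℚ P 1) :=
    Witness.isZero_homology_of_homotopyEquiv_sphere e one_ne_zero (by norm_num)
  exact hH (isZero_homology_of_isDouble _ hD h1)

/-- **Planarity may be put on either half**: the crux with `PlanarContactBoundary J₂` instead of
`J₁` is equivalent (swap the halves; all other conditions are symmetric). [folklore] -/
theorem planarBisectionRigidity_iff_right :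
    PlanarBisectionRigidity ↔
      ∀ (M : Type) [TopologicalSpace M] [T2Space M] [SecondCountableTopology M]
        [ChartedSpace 𝔼4 M] [IsManifold (𝓡 4) ∞ M], M ≃ₕ 𝕊⁴ →
        (∃ B : Witness M, PlanarContactBoundary B.J₂) → Nonempty (M ≃ₘ⟮𝓡 4, 𝓡 4⟯ 𝕊⁴) := by
  rw [planarBisectionRigidity_iff]
  constructor
  · intro h M _ _ _ _ _ e ⟨B, hB⟩
    exact h M e ⟨B.swap, hB⟩
  · intro h M _ _ _ _ _ e ⟨B, hB⟩
    exact h M e ⟨B.swap, hB⟩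

/-! ## §4 Relation to the sibling cruxes: what exactly must be vendored -/

/-- **The cite-fact that merges the two rigidity cruxes** (Etnyre arXiv:math/0404267 Thm 4.1 +
Mayer–Vietoris in the homology sphere): over a homotopy 4-sphere, a witness with planar first half
has ℚ-acyclic halves. NOT in the tree (needs `b₂⁺ = b₂⁰ = 0` for planar fillings and `Q ≡ 0` for
codimension-0 pieces of a homology sphere). [cite: arXiv:math/0404267, Thm. 4.1] -/
def PlanarImpliesAcyclic : Prop :=
  ∀ (M : Type) [TopologicalSpace M] [T2Space M] [SecondCountableTopology M]
    [ChartedSpace 𝔼4 M] [IsManifold (𝓡 4) ∞ M], M ≃ₕ 𝕊⁴ → ∀ B : Witness M, Planar B → B.Acyclic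

/-- **The same fact in the weakest sufficient form** (by the sibling's Mayer–Vietoris package,
`Witness.acyclic_iff_connected_and_seam`): planar first half ⇒ both halves connected and the seam
`∂W₁` a ℚ-homology sphere in degrees 1 and 2. On paper: Etnyre Thm 4.1 gives `∂Wᵢ` connected and
`b₂⁺(Wᵢ) + b₂⁰(Wᵢ) = 0` for BOTH halves (planarity transfers across the seam contactomorphism,
the contact orientation being intrinsic), `Q(Wᵢ) ≡ 0` inside the homology sphere gives
`b₂(Wᵢ) = 0`, MV gives `b₂(Γ) = b₂(W₁) + b₂(W₂) = 0`, Poincaré duality `b₁(Γ) = b₂(Γ) = 0`;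
connectedness of the halves from connectedness of `M` and of `∂Wᵢ`. [cite: arXiv:math/0404267, Thm. 4.1] -/
def PlanarImpliesConnectedQHSSeam : Prop :=
  ∀ (M : Type) [TopologicalSpace M] [T2Space M] [SecondCountableTopology M]
    [ChartedSpace 𝔼4 M] [IsManifold (𝓡 4) ∞ M], M ≃ₕ 𝕊⁴ → ∀ B : Witness M, Planar B →
    ConnectedSpace B.W₁ ∧ ConnectedSpace B.W₂ ∧
      IsZero (singularHomology ℚ ℚ B.Bd₁ 1) ∧ IsZero (singularHomology ℚ ℚ B.Bd₁ 2)

/-- The seam form implies the acyclic form (sibling MV package; `M ≠ ∅` from planarity).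
[folklore] -/
theorem planarImpliesAcyclic_of_seam (h : PlanarImpliesConnectedQHSSeam) : PlanarImpliesAcyclic := by
  intro M _ _ _ _ _ e B hB
  haveI : Nonempty M := nonempty_of_hasPlanarSteinBisection ⟨B, hB⟩
  exact (B.acyclic_iff_connected_and_seam e).2 (h M e B hB)

/-- **`AcyclicBisectionRigidity` + Etnyre ⇒ `PlanarBisectionRigidity`** — the informal "special
case" relation of the two cruxes, with its hidden cite-fact made an explicit hypothesis.
[folklore] -/
theorem of_acyclicBisectionRigidity (hEt : PlanarImpliesAcyclic) (h : AcyclicBisectionRigidity) :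
    PlanarBisectionRigidity := by
  rw [planarBisectionRigidity_iff]
  intro M _ _ _ _ _ e ⟨B, hB⟩
  have hA := hEt M e B hB
  exact h M e ⟨B.W₁, inferInstance, inferInstance, inferInstance, inferInstance, B.W₂, inferInstance,
    inferInstance, inferInstance, inferInstance, B.J₁, B.J₂, B.e₁, B.e₂, B.emb₁, B.emb₂, B.cover,
    B.inter₁, B.inter₂, B.contact, hA⟩

/-- The same with the weakest form of the cite-fact. [folklore] -/
theorem of_acyclicBisectionRigidity' (hEt : PlanarImpliesConnectedQHSSeam)
    (h : AcyclicBisectionRigidity) : PlanarBisectionRigidity :=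
  of_acyclicBisectionRigidity (planarImpliesAcyclic_of_seam hEt) h

/-! ## §5 Non-vacuity and tightness at the round `S⁴` (modulo gap G1) -/

/-! ### §5a GAP G1 CLOSED (gen 3, v7.2): the standard disc open book of `S³` supports `ξ_std`

The FIRST inhabitant of the tree's `OpenBook` / `Supports` / `IsPlanar` / `PlanarContactBoundary`
interface: binding `B = {z₁ = 0}` with its tube `(p, w) ↦ (w, p)/√(1 + ‖w‖²)`, fibration
`π = z₁/‖z₁‖`, pages the open discs `{arg z₁ = c}`, Giroux form `α = ⟪J₀ z, ·⟫|_{S³}`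
(`= Σⱼ (xⱼdyⱼ - yⱼdxⱼ)`; Etnyre 2006, example after Def. 2.1; Wendl 2020, Fig. 5.1; Geiges 2008,
Ex. 2.1.7).  All four Giroux conditions are checked: `ker α = ξ` (the complex tangencies of `∂𝔻⁴`,
tree `mem_contactPlane_steinStructureClosedBall_iff`), `α ∧ dα ≠ 0` (`= 2` on `(J₀y, Ky, J₀Ky)`),
`dα > 0` on pages (polynomial identity `‖z₁‖²·(α∧dα)(N,U,V) = dα(U,V)·‖z₁‖²dθ(N)`,
`pages_algebra`), `α > 0` on the binding as boundary of the pages; planarity by the continuous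
injection `z ↦ (z₂, ‖z₁‖)` of each page into `S²`.  The same content is filed for landing as
`Theorems/PlanarBisectionRigidity/Negative/Sphere{ContactForm,OpenBookTube,OpenBookCore,OpenBook}.lean`
(gate pending at the time of writing); it is inlined here so that this work file is SORRY-FREE. -/

namespace SphereOpenBook

/-- Local notation: `ℝ⁴ = ℂ²`. -/
local notation "E4" => EuclideanSpace ℝ (Fin 4)
/-- Local notation: `ℝ³` (the chart model of `S³`). -/
local notation "E3" => EuclideanSpace ℝ (Fin 3)
/-- Local notation: `ℝ² = ℂ`. -/
local notation "E2" => EuclideanSpace ℝ (Fin 2)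
/-- Local notation: `ℝ¹` (the chart model of `S¹`). -/
local notation "E1" => EuclideanSpace ℝ (Fin 1)
/-- Local notation: the unit sphere `S³ ⊂ ℂ²`. -/
local notation "S3" => (Metric.sphere (0 : EuclideanSpace ℝ (Fin 4)) 1)
/-- Local notation: the unit circle `S¹ ⊂ ℂ`. -/
local notation "S1" => (Metric.sphere (0 : EuclideanSpace ℝ (Fin 2)) 1)
/-- Local notation: the standard complex structure `J₀` of `ℝ⁴ = ℂ²`. -/
local notation "J₀" => stdComplexStructure

attribute [local instance] Literature.Topology.FourManifolds.fact_finrank_euclideanSpace_succ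

/-! ### The differential of the inclusion `S³ ⊂ ℝ⁴` -/

/-- **`D_y`: the differential at `y` of the inclusion `S³ ↪ ℝ⁴`**, from the chart model `ℝ³` of
`T_yS³` to the ambient `ℝ⁴` (Mathlib's `mfderiv` of `Subtype.val`). [folklore] -/
def D (y : S3) : E3 →L[ℝ] E4 :=
  mfderiv (𝓡 3) 𝓘(ℝ, E4) (Subtype.val : S3 → E4) y

/-- The range of `D_y` is the orthogonal complement of `y` (Mathlib). [folklore] -/
theorem range_D (y : S3) : (D y).range = (ℝ ∙ (y : E4))ᗮ :=
  range_mfderiv_coe_sphere (n := 3) y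

/-- `D_y` is injective (Mathlib). [folklore] -/
theorem D_injective (y : S3) : Injective (D y) :=
  mfderiv_coe_sphere_injective (n := 3) y

/-- Tangent vectors are orthogonal to the position vector: `⟪y, D_y v⟫ = 0`. [folklore] -/
theorem inner_D (y : S3) (v : E3) : ⟪(y : E4), D y v⟫ = 0 := by
  have h : D y v ∈ (D y).range := ⟨v, rfl⟩
  rw [range_D] at h
  exact (Submodule.mem_orthogonal_singleton_iff_inner_right).1 h

/-- Every vector orthogonal to `y` is a tangent vector: `⟪y, N⟫ = 0 → ∃ v, D_y v = N`. [folklore] -/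
theorem exists_D_eq (y : S3) {N : E4} (h : ⟪(y : E4), N⟫ = 0) : ∃ v : E3, D y v = N := by
  have hN : N ∈ (D y).range := by
    rw [range_D]
    exact (Submodule.mem_orthogonal_singleton_iff_inner_right).2 h
  exact hN

/-- `D_y v = 0 ↔ v = 0`. [folklore] -/
theorem D_eq_zero_iff (y : S3) (v : E3) : D y v = 0 ↔ v = 0 :=
  ⟨fun h => D_injective y (by rw [h, map_zero]), fun h => by rw [h, map_zero]⟩

/-! ### The ambient 1-form `A_x = ⟪J₀ x, ·⟫` and its exterior derivative `2ω₀` -/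

/-- The inner product on `ℝ⁴` in coordinates. [folklore] -/
theorem inner_eq_sum (x y : E4) : ⟪x, y⟫ = x 0 * y 0 + x 1 * y 1 + x 2 * y 2 + x 3 * y 3 := by
  simp [PiLp.inner_apply, Fin.sum_univ_four, mul_comm]

/-- `⟪J₀ x, v⟫` in coordinates. [folklore] -/
theorem inner_J_eq (x v : E4) :
    ⟪J₀ x, v⟫ = x 0 * v 1 - x 1 * v 0 + x 2 * v 3 - x 3 * v 2 := by
  rw [inner_eq_sum]
  simp
  ring

/-- **The ambient 1-form `A_x(v) = ⟪J₀ x, v⟫`** on `ℝ⁴` (half of `-d^ℂ |z|²`; the standard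
contact form of `S³` is its restriction), as a form in Mathlib's sense. [folklore] -/
def ambForm : E4 → E4 [⋀^Fin 1]→L[ℝ] ℝ := fun x =>
  ContinuousAlternatingMap.ofSubsingleton ℝ E4 ℝ (0 : Fin 1) (innerSL ℝ (J₀ x))

/-- `A_x(v) = ⟪J₀ x, v₀⟫`. [folklore] -/
@[simp] theorem ambForm_apply (x : E4) (v : Fin 1 → E4) : ambForm x v = ⟪J₀ x, v 0⟫ :=
  rfl

/-- `A` as a linear map `ℝ⁴ → (1-forms)` (it is linear in the point). [folklore] -/
def ambFormLin : E4 →ₗ[ℝ] (E4 [⋀^Fin 1]→L[ℝ] ℝ) where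
  toFun := ambForm
  map_add' x y := by ext v; simp [inner_add_left]
  map_smul' c x := by ext v; simp [inner_smul_left]

/-- `A` as a continuous linear map. [folklore] -/
def ambFormCLM : E4 →L[ℝ] (E4 [⋀^Fin 1]→L[ℝ] ℝ) :=
  LinearMap.toContinuousLinearMap ambFormLin

/-- `ambFormCLM` is `ambForm`. [folklore] -/
@[simp] theorem ambFormCLM_apply (x : E4) : ambFormCLM x = ambForm x := rfl

/-- `A` is `C^∞` (it is linear). [folklore] -/
theorem contDiff_ambForm : ContDiff ℝ ∞ ambForm :=
  ambFormCLM.contDiff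

/-- `A` is differentiable. [folklore] -/
theorem differentiableAt_ambForm (x : E4) : DifferentiableAt ℝ ambForm x :=
  (ambFormCLM.differentiable : Differentiable ℝ ambForm) x

/-- The coefficient functional `x ↦ A_x(c) = ⟪J₀ x, c⟫` is the continuous linear map
`-⟪J₀ c, ·⟫`. [folklore] -/
theorem ambForm_apply_const_eq (c : Fin 1 → E4) :
    (fun x : E4 => ambForm x c) = fun x => -(innerSL ℝ (J₀ (c 0))) x := by
  funext x
  rw [ambForm_apply, innerSL_apply_apply, inner_J_eq, inner_J_eq]
  ring

/-- **`dA = 2ω₀`**: `(dA)_x(u, v) = 2⟪J₀ u, v⟫` (Mathlib's normalisation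
`dα(v₀, v₁) = ∂_{v₀}α(v₁) - ∂_{v₁}α(v₀)`). [folklore] -/
theorem extDeriv_ambForm (x : E4) (v : Fin 2 → E4) :
    extDeriv ambForm x v = 2 * ⟪J₀ (v 0), v 1⟫ := by
  rw [extDeriv_apply (differentiableAt_ambForm x), Fin.sum_univ_two]
  have e0 : Fin.removeNth (0 : Fin 2) v 0 = v 1 := rfl
  have e1 : Fin.removeNth (1 : Fin 2) v 0 = v 0 := rfl
  have h0 : (fun x : E4 => ambForm x (Fin.removeNth 0 v)) =
      fun x => -(innerSL ℝ (J₀ (v 1))) x := by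
    rw [ambForm_apply_const_eq, e0]
  have h1 : (fun x : E4 => ambForm x (Fin.removeNth 1 v)) =
      fun x => -(innerSL ℝ (J₀ (v 0))) x := by
    rw [ambForm_apply_const_eq, e1]
  rw [h0, h1, fderiv_fun_neg, fderiv_fun_neg, ContinuousLinearMap.fderiv, ContinuousLinearMap.fderiv]
  simp only [Fin.val_zero, pow_zero, one_smul, Fin.val_one, pow_one, neg_smul,
    neg_apply, innerSL_apply_apply]
  simp only [inner_J_eq]
  ring

/-! ### The restriction `α = A|_{S³}` (the Giroux form) and `dα` -/

/-- **The standard contact form of `S³`**, `α = A|_{S³}`, as a 1-form on the manifold `S³`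
(pull-back of `A` along the inclusion). [folklore] -/
def girouxForm : MForm (𝓡 3) S3 ℝ 1 :=
  MForm.pullback (I' := 𝓘(ℝ, E4)) (𝓡 3) (Subtype.val : S3 → E4) ambForm

/-- `α_y(v) = ⟪J₀ y, D_y v⟫`. [folklore] -/
theorem girouxForm_apply (y : S3) (v : E3) : girouxForm y ![v] = ⟪J₀ (y : E4), D y v⟫ :=
  rfl

/-- In the flat case the chart representative of a form is the form itself. [folklore] -/
theorem inChart_eq_self_flat {k : ℕ} (β : MForm 𝓘(ℝ, E4) E4 ℝ k) (z : E4) : β.inChart z = β := by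
  funext y
  ext v
  simp [MForm.inChart_apply]
  rfl

/-- In the flat case a `C^∞` form is smooth at every point. [folklore] -/
theorem smoothAt_flat_of_contDiff {k : ℕ} {β : E4 → E4 [⋀^Fin k]→L[ℝ] ℝ} (h : ContDiff ℝ ∞ β)
    (z : E4) : MForm.SmoothAt (I := 𝓘(ℝ, E4)) β z := by
  rw [MForm.SmoothAt, inChart_eq_self_flat]
  simp only [modelWithCornersSelf_coe, range_id, extChartAt_self_apply]
  exact h.contDiffAt.contDiffWithinAt

/-- The inclusion `S³ ↪ ℝ⁴` is `C^∞` near every point (Mathlib). [folklore] -/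
theorem eventually_contMDiffAt_val (y : S3) :
    ∀ᶠ z in 𝓝 y, ContMDiffAt (𝓡 3) 𝓘(ℝ, E4) ∞ (Subtype.val : S3 → E4) z :=
  Filter.Eventually.of_forall fun z => (contMDiff_coe_sphere (n := 3)) z

/-- **`α` is a `C^∞` form on `S³`.** [folklore] -/
theorem isSmoothForm_girouxForm : IsSmoothForm girouxForm := fun y =>
  MForm.SmoothAt.pullback (eventually_contMDiffAt_val y) (smoothAt_flat_of_contDiff contDiff_ambForm _)

/-- **`(dα)_y(u, v) = 2⟪J₀ D_y u, D_y v⟫`** (naturality of `d` + `dA = 2ω₀`). [folklore] -/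
theorem mextDeriv_girouxForm_apply (y : S3) (u v : E3) :
    mextDeriv girouxForm y ![u, v] = 2 * ⟪J₀ (D y u), D y v⟫ := by
  rw [girouxForm, mextDeriv_pullback_apply (eventually_contMDiffAt_val y)
    (smoothAt_flat_of_contDiff contDiff_ambForm _), MForm.pullback_apply, mextDeriv_eq_extDeriv]
  exact extDeriv_ambForm (y : E4) _


/-! ### The coordinates `z₁ = (x₀, x₁)` and `z₂ = (x₂, x₃)` of `ℝ⁴ = ℂ²` -/

/-- The inner product on `ℝ²` in coordinates. [folklore] -/
theorem inner_eq_sum₂ (a b : E2) : ⟪a, b⟫ = a 0 * b 0 + a 1 * b 1 := by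
  simp [PiLp.inner_apply, Fin.sum_univ_two, mul_comm]

/-- `‖a‖² = a₀² + a₁²` on `ℝ²`. [folklore] -/
theorem norm_sq_eq₂ (a : E2) : ‖a‖ ^ 2 = a 0 * a 0 + a 1 * a 1 := by
  rw [← real_inner_self_eq_norm_sq, inner_eq_sum₂]

/-- `‖x‖² = x₀² + x₁² + x₂² + x₃²` on `ℝ⁴`. [folklore] -/
theorem norm_sq_eq₄ (x : E4) : ‖x‖ ^ 2 = x 0 * x 0 + x 1 * x 1 + x 2 * x 2 + x 3 * x 3 := by
  rw [← real_inner_self_eq_norm_sq, inner_eq_sum]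

/-- The first complex coordinate `z₁ = (x₀, x₁)`, as a linear map. [folklore] -/
def pr₁Lin : E4 →ₗ[ℝ] E2 where
  toFun x := !₂[x 0, x 1]
  map_add' x y := by ext i; fin_cases i <;> simp
  map_smul' c x := by ext i; fin_cases i <;> simp

/-- **The first complex coordinate `z₁ : ℂ² → ℂ`.** [folklore] -/
def pr₁ : E4 →L[ℝ] E2 :=
  LinearMap.toContinuousLinearMap pr₁Lin

/-- The second complex coordinate `z₂ = (x₂, x₃)`, as a linear map. [folklore] -/
def pr₂Lin : E4 →ₗ[ℝ] E2 where
  toFun x := !₂[x 2, x 3]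
  map_add' x y := by ext i; fin_cases i <;> simp
  map_smul' c x := by ext i; fin_cases i <;> simp

/-- **The second complex coordinate `z₂ : ℂ² → ℂ`.** [folklore] -/
def pr₂ : E4 →L[ℝ] E2 :=
  LinearMap.toContinuousLinearMap pr₂Lin

@[simp] theorem pr₁_apply_zero (x : E4) : pr₁ x 0 = x 0 := rfl
@[simp] theorem pr₁_apply_one (x : E4) : pr₁ x 1 = x 1 := rfl
@[simp] theorem pr₂_apply_zero (x : E4) : pr₂ x 0 = x 2 := rfl
@[simp] theorem pr₂_apply_one (x : E4) : pr₂ x 1 = x 3 := rfl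

/-- `‖x‖² = ‖z₁‖² + ‖z₂‖²`. [folklore] -/
theorem norm_sq_eq_add (x : E4) : ‖x‖ ^ 2 = ‖pr₁ x‖ ^ 2 + ‖pr₂ x‖ ^ 2 := by
  rw [norm_sq_eq₄, norm_sq_eq₂, norm_sq_eq₂]
  simp only [pr₁_apply_zero, pr₁_apply_one, pr₂_apply_zero, pr₂_apply_one]
  ring

/-- On the sphere, `‖z₁‖² + ‖z₂‖² = 1`. [folklore] -/
theorem norm_sq_pr_add (y : S3) : ‖pr₁ (y : E4)‖ ^ 2 + ‖pr₂ (y : E4)‖ ^ 2 = 1 := by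
  rw [← norm_sq_eq_add, norm_eq_of_mem_sphere y, one_pow]

/-- **Juxtaposition `(a, b) ↦ (a₀, a₁, b₀, b₁)`: `ℂ × ℂ → ℂ²`**, as a linear map. [folklore] -/
def joinLin : E2 × E2 →ₗ[ℝ] E4 where
  toFun q := !₂[q.1 0, q.1 1, q.2 0, q.2 1]
  map_add' q q' := by ext i; fin_cases i <;> simp
  map_smul' c q := by ext i; fin_cases i <;> simp

/-- Juxtaposition as a continuous linear map. [folklore] -/
def join : E2 × E2 →L[ℝ] E4 :=
  LinearMap.toContinuousLinearMap joinLin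

@[simp] theorem join_apply_zero (q : E2 × E2) : join q 0 = q.1 0 := rfl
@[simp] theorem join_apply_one (q : E2 × E2) : join q 1 = q.1 1 := rfl
@[simp] theorem join_apply_two (q : E2 × E2) : join q 2 = q.2 0 := rfl
@[simp] theorem join_apply_three (q : E2 × E2) : join q 3 = q.2 1 := rfl

@[simp] theorem pr₁_join (q : E2 × E2) : pr₁ (join q) = q.1 := by
  ext i; fin_cases i <;> rfl

@[simp] theorem pr₂_join (q : E2 × E2) : pr₂ (join q) = q.2 := by
  ext i; fin_cases i <;> rfl

/-- `x = (z₁, z₂)` juxtaposed. [folklore] -/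
theorem join_pr (x : E4) : join (pr₁ x, pr₂ x) = x := by
  ext i; fin_cases i <;> rfl

/-- `‖(a, b)‖² = ‖a‖² + ‖b‖²` for the juxtaposition. [folklore] -/
theorem norm_sq_join (q : E2 × E2) : ‖join q‖ ^ 2 = ‖q.1‖ ^ 2 + ‖q.2‖ ^ 2 := by
  rw [norm_sq_eq_add, pr₁_join, pr₂_join]

/-! ### The binding tube `S¹ × ℝ² → S³`, `(p, w) ↦ (w, p)/√(1 + ‖w‖²)` -/

/-- The radial rescaling `s(w) = 1/√(1 + ‖w‖²)`. [folklore] -/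
def tubeScale (w : E2) : ℝ :=
  (√(1 + ‖w‖ ^ 2))⁻¹

theorem one_add_norm_sq_pos (w : E2) : 0 < 1 + ‖w‖ ^ 2 := by positivity

theorem tubeScale_pos (w : E2) : 0 < tubeScale w :=
  inv_pos.2 (Real.sqrt_pos.2 (one_add_norm_sq_pos w))

/-- `s(w)² (1 + ‖w‖²) = 1`. [folklore] -/
theorem tubeScale_sq_mul (w : E2) : tubeScale w ^ 2 * (1 + ‖w‖ ^ 2) = 1 := by
  rw [tubeScale, inv_pow, Real.sq_sqrt (one_add_norm_sq_pos w).le,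
    inv_mul_cancel₀ (one_add_norm_sq_pos w).ne']

@[simp] theorem tubeScale_zero : tubeScale 0 = 1 := by
  simp [tubeScale]

/-- `s` is `C^∞`. [folklore] -/
theorem contDiff_tubeScale : ContDiff ℝ ∞ tubeScale := by
  have h1 : ContDiff ℝ ∞ fun w : E2 => 1 + ‖w‖ ^ 2 := contDiff_const.add (contDiff_norm_sq ℝ)
  have h2 : ContDiff ℝ ∞ fun w : E2 => √(1 + ‖w‖ ^ 2) :=
    h1.sqrt fun w => (one_add_norm_sq_pos w).ne'
  exact h2.inv fun w => (Real.sqrt_pos.2 (one_add_norm_sq_pos w)).ne'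

/-- **The tube in ambient coordinates**: `(p, w) ↦ s(w) · (w, p) ∈ ℂ²` (`z₁ = s w`, `z₂ = s p`).
[folklore] -/
def tubeAmb (q : E2 × E2) : E4 :=
  tubeScale q.2 • join (q.2, q.1)

theorem pr₁_tubeAmb (q : E2 × E2) : pr₁ (tubeAmb q) = tubeScale q.2 • q.2 := by
  simp [tubeAmb]

theorem pr₂_tubeAmb (q : E2 × E2) : pr₂ (tubeAmb q) = tubeScale q.2 • q.1 := by
  simp [tubeAmb]

/-- `tubeAmb` is `C^∞`. [folklore] -/
theorem contDiff_tubeAmb : ContDiff ℝ ∞ tubeAmb :=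
  (contDiff_tubeScale.comp contDiff_snd).smul (join.contDiff.comp (contDiff_snd.prodMk contDiff_fst))

/-- On `‖p‖ = 1` the tube lands in `S³`: `‖s(w)(w, p)‖² = s²(‖w‖² + 1) = 1`. [folklore] -/
theorem norm_tubeAmb (p : S1) (w : E2) : ‖tubeAmb ((p : E2), w)‖ = 1 := by
  have h : ‖tubeAmb ((p : E2), w)‖ ^ 2 = 1 := by
    rw [tubeAmb, norm_smul, mul_pow, Real.norm_eq_abs, sq_abs, norm_sq_join]
    simp only [norm_eq_of_mem_sphere p, one_pow]
    rw [add_comm]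
    exact tubeScale_sq_mul w
  exact (pow_eq_one_iff_of_nonneg (norm_nonneg _) two_ne_zero).1 h

theorem tubeAmb_mem (q : S1 × E2) : tubeAmb ((q.1 : E2), q.2) ∈ S3 :=
  mem_sphere_zero_iff_norm.2 (norm_tubeAmb q.1 q.2)

/-- **The binding tube `S¹ × ℝ² → S³`**, `(p, w) ↦ (w, p)/√(1 + ‖w‖²)`; its core `w = 0` is the
binding circle `{z₁ = 0}`. [folklore] -/
def tube : S1 × E2 → S3 :=
  Set.codRestrict (fun q : S1 × E2 => tubeAmb ((q.1 : E2), q.2)) _ tubeAmb_mem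

@[simp] theorem coe_tube (q : S1 × E2) : (tube q : E4) = tubeAmb ((q.1 : E2), q.2) := rfl

theorem pr₁_tube (p : S1) (w : E2) : pr₁ (tube (p, w) : E4) = tubeScale w • w := by
  rw [coe_tube, pr₁_tubeAmb]

theorem pr₂_tube (p : S1) (w : E2) : pr₂ (tube (p, w) : E4) = tubeScale w • (p : E2) := by
  rw [coe_tube, pr₂_tubeAmb]

/-- The tube is `C^∞`. [folklore] -/
theorem contMDiff_tube : ContMDiff ((𝓡 1).prod 𝓘(ℝ, E2)) (𝓡 3) ∞ tube :=
  (contDiff_tubeAmb.contMDiff.comp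
    (((contMDiff_coe_sphere (n := 1)).comp contMDiff_fst).prodMk_space contMDiff_snd)).codRestrict_sphere _

/-- The tube is continuous. [folklore] -/
theorem continuous_tube : Continuous tube :=
  contMDiff_tube.continuous

/-- `z₂ ≠ 0` on the image of the tube. [folklore] -/
theorem pr₂_tube_ne_zero (p : S1) (w : E2) : pr₂ (tube (p, w) : E4) ≠ 0 := by
  rw [pr₂_tube]
  exact smul_ne_zero (tubeScale_pos w).ne' (ne_zero_of_mem_unit_sphere p)

theorem norm_pr₂_tube (p : S1) (w : E2) : ‖pr₂ (tube (p, w) : E4)‖ = tubeScale w := by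
  rw [pr₂_tube, norm_smul, norm_eq_of_mem_sphere p, mul_one, Real.norm_eq_abs,
    abs_of_pos (tubeScale_pos w)]

/-- **The inverse of the tube on `{z₂ ≠ 0}`**: `z ↦ (z₂/‖z₂‖, z₁/‖z₂‖)`. [folklore] -/
def tubeInv (z : S3) : S1 × E2 :=
  (RotationBody.sphN (m := 1) (pr₂ (z : E4)), ‖pr₂ (z : E4)‖⁻¹ • pr₁ (z : E4))

/-- `tubeInv ∘ tube = id`. [folklore] -/
theorem tubeInv_tube (q : S1 × E2) : tubeInv (tube q) = q := by
  obtain ⟨p, w⟩ := q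
  simp only [tubeInv]
  rw [norm_pr₂_tube, pr₂_tube, pr₁_tube,
    RotationBody.sphN_smul (tubeScale_pos w) (ne_zero_of_mem_unit_sphere p), RotationBody.sphN_coe,
    smul_smul, inv_mul_cancel₀ (tubeScale_pos w).ne', one_smul]

/-- The tube is injective. [folklore] -/
theorem injective_tube : Injective tube :=
  HasLeftInverse.injective ⟨tubeInv, tubeInv_tube⟩

/-- `tube ∘ tubeInv = id` on `{z₂ ≠ 0}`. [folklore] -/
theorem tube_tubeInv {z : S3} (hz : pr₂ (z : E4) ≠ 0) : tube (tubeInv z) = z := by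
  have hn : 0 < ‖pr₂ (z : E4)‖ := norm_pos_iff.2 hz
  have hw : ‖‖pr₂ (z : E4)‖⁻¹ • pr₁ (z : E4)‖ ^ 2 = ‖pr₂ (z : E4)‖⁻¹ ^ 2 * ‖pr₁ (z : E4)‖ ^ 2 := by
    rw [norm_smul, mul_pow, norm_inv, norm_norm]
  have hs : tubeScale (‖pr₂ (z : E4)‖⁻¹ • pr₁ (z : E4)) = ‖pr₂ (z : E4)‖ := by
    have h1 : 1 + ‖‖pr₂ (z : E4)‖⁻¹ • pr₁ (z : E4)‖ ^ 2 = (‖pr₂ (z : E4)‖⁻¹) ^ 2 := by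
      rw [hw]
      have := norm_sq_pr_add z
      field_simp
      nlinarith [this]
    rw [tubeScale, h1, Real.sqrt_sq (inv_nonneg.2 hn.le), inv_inv]
  apply Subtype.ext
  apply_fun join ∘ fun x : E4 => (pr₁ x, pr₂ x) using
    fun a b h => by simpa [join_pr] using h
  simp only [comp_apply, join_pr, tubeInv, coe_tube, tubeAmb, hs, RotationBody.coe_sphN hz]
  ext i
  fin_cases i <;> simp [mul_inv_cancel_left₀ hn.ne']

/-- **The image of the tube is `{z₂ ≠ 0}`.** [folklore] -/
theorem range_tube : range tube = {z : S3 | pr₂ (z : E4) ≠ 0} := by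
  ext z
  constructor
  · rintro ⟨⟨p, w⟩, rfl⟩
    exact pr₂_tube_ne_zero p w
  · intro hz
    exact ⟨tubeInv z, tube_tubeInv hz⟩

/-- The image of the tube is open. [folklore] -/
theorem isOpen_range_tube : IsOpen (range tube) := by
  rw [range_tube]
  exact isOpen_ne.preimage (pr₂.continuous.comp continuous_subtype_val)

/-- `tubeInv` is `C^∞` on `{z₂ ≠ 0}`. [folklore] -/
theorem contMDiffOn_tubeInv : ContMDiffOn (𝓡 3) ((𝓡 1).prod 𝓘(ℝ, E2)) ∞ tubeInv (range tube) := by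
  rw [range_tube]
  have hval : ContMDiff (𝓡 3) 𝓘(ℝ, E4) ∞ (Subtype.val : S3 → E4) := contMDiff_coe_sphere (n := 3)
  have h2 : ContMDiff (𝓡 3) 𝓘(ℝ, E2) ∞ fun z : S3 => pr₂ (z : E4) := pr₂.contDiff.contMDiff.comp hval
  have h1 : ContMDiff (𝓡 3) 𝓘(ℝ, E2) ∞ fun z : S3 => pr₁ (z : E4) := pr₁.contDiff.contMDiff.comp hval
  have h3 : ContMDiffOn (𝓡 3) 𝓘(ℝ) ∞ (fun z : S3 => ‖pr₂ (z : E4)‖) {z : S3 | pr₂ (z : E4) ≠ 0} :=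
    fun z hz => (contDiffAt_norm ℝ hz).comp_contMDiffWithinAt (f := fun z : S3 => pr₂ (z : E4))
      (x := z) (h2 z).contMDiffWithinAt
  have h4 : ContMDiffOn (𝓡 3) 𝓘(ℝ) ∞ (fun z : S3 => ‖pr₂ (z : E4)‖⁻¹) {z : S3 | pr₂ (z : E4) ≠ 0} :=
    fun z hz => (contDiffAt_inv ℝ (norm_ne_zero_iff.2 hz)).comp_contMDiffWithinAt
      (f := fun z : S3 => ‖pr₂ (z : E4)‖) (x := z) (h3 z hz)
  refine ContMDiffOn.prodMk ?_ (h4.smul h1.contMDiffOn)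
  exact RotationBody.contMDiffOn_sphN.comp h2.contMDiffOn fun z hz => hz

/-! ### The tube is an open smooth embedding -/

/-- The tube is an open map (continuous inverse on its open range). [folklore] -/
theorem isOpenMap_tube : IsOpenMap tube := by
  intro U hU
  have hcont : ContinuousOn tubeInv (range tube) := contMDiffOn_tubeInv.continuousOn
  have h : tube '' U = range tube ∩ tubeInv ⁻¹' U := by
    ext z
    constructor
    · rintro ⟨q, hq, rfl⟩
      exact ⟨mem_range_self q, by rwa [mem_preimage, tubeInv_tube]⟩
    · rintro ⟨⟨q, rfl⟩, hz⟩
      rw [mem_preimage, tubeInv_tube] at hz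
      exact ⟨q, hz, rfl⟩
  rw [h]
  exact hcont.isOpen_inter_preimage isOpen_range_tube hU

/-- `ℝ¹ × ℝ² ≅ ℝ³` (dimension count for the embedding criterion). [folklore] -/
def modelEquiv : (E1 × E2) ≃L[ℝ] E3 :=
  ContinuousLinearEquiv.ofFinrankEq (by simp [Module.finrank_prod])

/-- **The tube is a `C^∞` embedding** (injective open `C^∞` map with a `C^∞` inverse on its
range; the tree's `isSmoothEmbedding_of_leftInverse_of_isOpenMap`). [folklore] -/
theorem isSmoothEmbedding_tube : Manifold.IsSmoothEmbedding ((𝓡 1).prod 𝓘(ℝ, E2)) (𝓡 3) ∞ tube :=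
  (Literature.Geometry.Manifold.isSmoothEmbedding_of_leftInverse_of_isOpenMap contMDiff_tube
    injective_tube isOpenMap_tube contMDiffOn_tubeInv tubeInv_tube modelEquiv).1

/-! ### The binding `{z₁ = 0}` and the fibration `π = z₁/‖z₁‖` -/

/-- Points with `z₁ = 0` have `‖z₂‖ = 1`. [folklore] -/
theorem norm_pr₂_of_pr₁_eq_zero {z : S3} (hz : pr₁ (z : E4) = 0) : ‖pr₂ (z : E4)‖ = 1 := by
  have h := norm_sq_pr_add z
  rw [hz, norm_zero, zero_pow two_ne_zero, zero_add] at h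
  exact (pow_eq_one_iff_of_nonneg (norm_nonneg _) two_ne_zero).1 h

/-- The core of the tube is `w = 0 ↦ (0, p)`. [folklore] -/
theorem coe_tube_zero (p : S1) : (tube (p, 0) : E4) = join (0, (p : E2)) := by
  rw [coe_tube, tubeAmb]
  simp

/-- **The binding of the one-tube family is the circle `{z₁ = 0}`.** [folklore] -/
theorem tubesBinding_eq : tubesBinding (fun _ : Fin 1 => tube) = {z : S3 | pr₁ (z : E4) = 0} := by
  ext z
  rw [mem_tubesBinding_iff, mem_setOf_eq]
  constructor
  · rintro ⟨-, p, rfl⟩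
    rw [pr₁_tube, smul_zero]
  · intro hz
    refine ⟨0, ⟨pr₂ (z : E4), mem_sphere_zero_iff_norm.2 (norm_pr₂_of_pr₁_eq_zero hz)⟩, ?_⟩
    apply Subtype.ext
    rw [coe_tube_zero]
    conv_rhs => rw [← join_pr (z : E4)]
    rw [hz]

/-- **The fibration `π : S³ → S¹`, `π(z) = z₁/‖z₁‖`** (junk value on the binding `z₁ = 0`).
[folklore] -/
def proj (z : S3) : S1 :=
  RotationBody.sphN (m := 1) (pr₁ (z : E4))

/-- Normal form: `π(tube(p, w)) = w/‖w‖` for `w ≠ 0`. [folklore] -/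
theorem coe_proj_tube (p : S1) {w : E2} (hw : w ≠ 0) :
    ((proj (tube (p, w)) : S1) : E2) = ‖w‖⁻¹ • w := by
  rw [proj, pr₁_tube, RotationBody.sphN_smul (tubeScale_pos w) hw, RotationBody.coe_sphN hw]

/-- `z ↦ z₁` is `C^∞` on `S³`. [folklore] -/
theorem contMDiff_pr₁ : ContMDiff (𝓡 3) 𝓘(ℝ, E2) ∞ fun z : S3 => pr₁ (z : E4) :=
  pr₁.contDiff.contMDiff.comp (contMDiff_coe_sphere (n := 3))

/-- `π` is `C^∞` off the binding. [folklore] -/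
theorem contMDiffOn_proj : ContMDiffOn (𝓡 3) (𝓡 1) ∞ proj {z : S3 | pr₁ (z : E4) ≠ 0} :=
  RotationBody.contMDiffOn_sphN.comp contMDiff_pr₁.contMDiffOn fun _ hz => hz

/-- `π` read in `ℝ²` is `sphFun` after `z ↦ z₁` (definitional). [folklore] -/
theorem coe_proj_eq : (fun z : S3 => ((proj z : S1) : E2)) =
    (RotationBody.sphFun ∘ ⇑pr₁) ∘ (Subtype.val : S3 → E4) :=
  rfl

/-! ### Derivatives: the normalisation `v ↦ v/‖v‖`, the angular differential of `π` -/

/-- **The derivative of `v ↦ v/‖v‖` at `u ≠ 0` has the shape `h ↦ ‖u‖⁻¹ h + ℓ(h) u`** for some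
linear functional `ℓ` (the precise `ℓ = -⟪u, ·⟫/‖u‖³` is never needed: the `u`-component drops
out of the angle form). [folklore] -/
theorem hasFDerivAt_normalize {u : E2} (hu : u ≠ 0) :
    ∃ ℓ : E2 →L[ℝ] ℝ, HasFDerivAt (fun v : E2 => ‖v‖⁻¹ • v)
      (‖u‖⁻¹ • ContinuousLinearMap.id ℝ E2 + ℓ.smulRight u) u := by
  have hs' : ContDiffAt ℝ ∞ (fun v : E2 => ‖v‖⁻¹) u :=
    (contDiffAt_norm ℝ hu).inv (norm_ne_zero_iff.2 hu)
  have hs : DifferentiableAt ℝ (fun v : E2 => ‖v‖⁻¹) u := hs'.differentiableAt (by simp)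
  exact ⟨fderiv ℝ (fun v : E2 => ‖v‖⁻¹) u, hs.hasFDerivAt.smul (hasFDerivAt_id u)⟩

/-- `sphFun = (v ↦ v/‖v‖)` near any `u ≠ 0`. [folklore] -/
theorem sphFun_eventuallyEq {u : E2} (hu : u ≠ 0) :
    (RotationBody.sphFun : E2 → E2) =ᶠ[𝓝 u] fun v => ‖v‖⁻¹ • v := by
  filter_upwards [isOpen_ne.mem_nhds hu] with v hv
  simp [RotationBody.sphFun, show v ≠ 0 from hv]

/-- The angle form kills the radial component: `dφ_{u/‖u‖}(‖u‖⁻¹ h + c u) = (u₀h₁ - u₁h₀)/‖u‖²`.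
[folklore] -/
theorem angleForm_normalize (u h : E2) (c : ℝ) :
    angleForm (‖u‖⁻¹ • u) (‖u‖⁻¹ • h + c • u) = (‖u‖ ^ 2)⁻¹ * (u 0 * h 1 - u 1 * h 0) := by
  rw [angleForm_apply]
  simp only [PiLp.smul_apply, PiLp.add_apply, smul_eq_mul]
  rw [← inv_pow]
  ring

/-- **The angular differential of `π` at `y ∉ B`**: `dθ_y(n) = (y₀ N₁ - y₁ N₀)/‖z₁(y)‖²` with
`N = D_y n` the ambient tangent vector. [folklore] -/
theorem angularDeriv_proj {y : S3} (hy : pr₁ (y : E4) ≠ 0) (n : E3) :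
    angularDeriv proj y n =
      (‖pr₁ (y : E4)‖ ^ 2)⁻¹ * ((y : E4) 0 * D y n 1 - (y : E4) 1 * D y n 0) := by
  obtain ⟨ℓ, hℓ⟩ := hasFDerivAt_normalize hy
  set L : E2 →L[ℝ] E2 :=
    ‖pr₁ (y : E4)‖⁻¹ • ContinuousLinearMap.id ℝ E2 + ℓ.smulRight (pr₁ (y : E4)) with hL
  -- the ambient map `g = sphFun ∘ z₁` is differentiable at `y` with derivative `L ∘ z₁`
  have hg : HasFDerivAt (RotationBody.sphFun ∘ ⇑pr₁) (L.comp pr₁) (y : E4) :=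
    (hℓ.congr_of_eventuallyEq (sphFun_eventuallyEq hy)).comp (y : E4) pr₁.hasFDerivAt
  have hgm : HasMFDerivAt 𝓘(ℝ, E4) 𝓘(ℝ, E2) (RotationBody.sphFun ∘ ⇑pr₁) (y : E4) (L.comp pr₁) :=
    hasMFDerivAt_iff_hasFDerivAt.2 hg
  have hval : HasMFDerivAt (𝓡 3) 𝓘(ℝ, E4) (Subtype.val : S3 → E4) y (D y) :=
    ((contMDiff_coe_sphere (m := ∞) (n := 3) y).mdifferentiableAt (by simp)).hasMFDerivAt
  have hcomp := hgm.comp y hval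
  rw [angularDeriv_apply, coe_proj_eq, hcomp.mfderiv]
  have hp : ((proj y : S1) : E2) = ‖pr₁ (y : E4)‖⁻¹ • pr₁ (y : E4) := RotationBody.coe_sphN hy
  rw [hp]
  show angleForm (‖pr₁ (y : E4)‖⁻¹ • pr₁ (y : E4)) (L (pr₁ (D y n))) = _
  rw [hL]
  show angleForm (‖pr₁ (y : E4)‖⁻¹ • pr₁ (y : E4))
      (‖pr₁ (y : E4)‖⁻¹ • pr₁ (D y n) + ℓ (pr₁ (D y n)) • pr₁ (y : E4)) = _
  rw [angleForm_normalize]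
  rfl

/-! ### Derivatives of the tube along its core: the binding tangent and the meridional frame -/

/-- **`D¹_x`: the differential of the inclusion `S¹ ↪ ℝ²`** at `x`. [folklore] -/
def D₁ (x : S1) : E1 →L[ℝ] E2 :=
  mfderiv (𝓡 1) 𝓘(ℝ, E2) (Subtype.val : S1 → E2) x

/-- The range of `D¹_x` is the orthogonal complement of `x` (Mathlib). [folklore] -/
theorem range_D₁ (x : S1) : (D₁ x).range = (ℝ ∙ (x : E2))ᗮ :=
  range_mfderiv_coe_sphere (n := 1) x

/-- Tangent vectors of the circle are orthogonal to the position vector. [folklore] -/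
theorem inner_D₁ (x : S1) (v : E1) : ⟪(x : E2), D₁ x v⟫ = 0 := by
  have h : D₁ x v ∈ (D₁ x).range := ⟨v, rfl⟩
  rw [range_D₁] at h
  exact (Submodule.mem_orthogonal_singleton_iff_inner_right).1 h

/-- `D¹_x` is injective. [folklore] -/
theorem D₁_injective (x : S1) : Injective (D₁ x) :=
  mfderiv_coe_sphere_injective (n := 1) x

/-- The inclusion `S¹ ↪ ℝ²` has derivative `D¹_x`. [folklore] -/
theorem hasMFDerivAt_val₁ (x : S1) :
    HasMFDerivAt (𝓡 1) 𝓘(ℝ, E2) (Subtype.val : S1 → E2) x (D₁ x) :=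
  ((contMDiff_coe_sphere (m := ∞) (n := 1) x).mdifferentiableAt (by simp)).hasMFDerivAt

/-- The inclusion `S³ ↪ ℝ⁴` has derivative `D_y`. [folklore] -/
theorem hasMFDerivAt_val (y : S3) :
    HasMFDerivAt (𝓡 3) 𝓘(ℝ, E4) (Subtype.val : S3 → E4) y (D y) :=
  ((contMDiff_coe_sphere (m := ∞) (n := 3) y).mdifferentiableAt (by simp)).hasMFDerivAt

/-- The tube is differentiable. [folklore] -/
theorem mdifferentiableAt_tube (q : S1 × E2) :
    MDifferentiableAt ((𝓡 1).prod 𝓘(ℝ, E2)) (𝓡 3) tube q :=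
  (contMDiff_tube q).mdifferentiableAt (by simp)

/-- Along the core the tube is the linear map `p ↦ (0, p)` restricted to `S¹`. [folklore] -/
theorem val_tube_core_eq :
    ((Subtype.val : S3 → E4) ∘ tube ∘ fun p : S1 => (p, (0 : E2))) =
      ⇑(join.comp (ContinuousLinearMap.inr ℝ E2 E2)) ∘ (Subtype.val : S1 → E2) := by
  funext p
  simp only [comp_apply, coe_tube_zero, ContinuousLinearMap.coe_comp, ContinuousLinearMap.inr_apply]

/-- **The binding tangent read ambiently**: `D (∂_v tube(·, 0)) = (0, D¹_x v)` — the tangent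
vector of the binding circle `{z₁ = 0}`. [folklore] -/
theorem D_mfderiv_tube_horizontal (x : S1) (v : E1) :
    D (tube (x, 0)) (mfderiv ((𝓡 1).prod 𝓘(ℝ, E2)) (𝓡 3) tube (x, 0) (v, 0)) =
      join (0, D₁ x v) := by
  have hc : HasMFDerivAt (𝓡 1) ((𝓡 1).prod 𝓘(ℝ, E2)) (fun p : S1 => (p, (0 : E2))) x
      ((ContinuousLinearMap.id ℝ E1).prod (0 : E1 →L[ℝ] E2)) :=
    (hasMFDerivAt_id x).prodMk (hasMFDerivAt_const (0 : E2) x)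
  have htc : HasMFDerivAt (𝓡 1) (𝓡 3) (tube ∘ fun p : S1 => (p, (0 : E2))) x
      ((mfderiv ((𝓡 1).prod 𝓘(ℝ, E2)) (𝓡 3) tube (x, 0)).comp
        ((ContinuousLinearMap.id ℝ E1).prod (0 : E1 →L[ℝ] E2))) :=
    (mdifferentiableAt_tube (x, 0)).hasMFDerivAt.comp x hc
  have hvtc := (hasMFDerivAt_val (tube (x, 0))).comp x htc
  have hlin : HasMFDerivAt (𝓡 1) 𝓘(ℝ, E4)
      (⇑(join.comp (ContinuousLinearMap.inr ℝ E2 E2)) ∘ (Subtype.val : S1 → E2)) x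
      ((join.comp (ContinuousLinearMap.inr ℝ E2 E2)).comp (D₁ x)) :=
    (hasMFDerivAt_iff_hasFDerivAt.2 (join.comp (ContinuousLinearMap.inr ℝ E2 E2)).hasFDerivAt).comp
      x (hasMFDerivAt_val₁ x)
  have heq : (Subtype.val : S3 → E4) ∘ (tube ∘ fun p : S1 => (p, (0 : E2))) =
      ⇑(join.comp (ContinuousLinearMap.inr ℝ E2 E2)) ∘ (Subtype.val : S1 → E2) :=
    val_tube_core_eq
  rw [heq] at hvtc
  exact congrArg (fun L : E1 →L[ℝ] E4 => L v) (hvtc.mfderiv.symm.trans hlin.mfderiv)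

/-- `s` has vanishing derivative at `w = 0` (it is even). [folklore] -/
theorem hasFDerivAt_tubeScale_zero : HasFDerivAt tubeScale (0 : E2 →L[ℝ] ℝ) 0 := by
  have h1 : HasFDerivAt (fun w : E2 => 1 + ‖w‖ ^ 2) (0 : E2 →L[ℝ] ℝ) 0 := by
    have := ((hasStrictFDerivAt_norm_sq (0 : E2)).hasFDerivAt).const_add 1
    simpa using this
  have h2 : HasFDerivAt (fun w : E2 => √(1 + ‖w‖ ^ 2)) (0 : E2 →L[ℝ] ℝ) 0 := by
    have := h1.sqrt (by simp)
    simpa using this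
  have h3 := (hasDerivAt_inv (x := √(1 + ‖(0 : E2)‖ ^ 2)) (by simp)).comp_hasFDerivAt (0 : E2) h2
  rw [smul_zero] at h3
  exact h3

/-- **The tube in the meridional direction at the core**: `∂_h tube(p, ·)|₀ = (h, 0)` ambiently.
[folklore] -/
theorem hasFDerivAt_tubeAmb_vertical (a : E2) :
    HasFDerivAt (fun w : E2 => tubeAmb (a, w)) (join.comp (ContinuousLinearMap.inl ℝ E2 E2)) 0 := by
  have hj : HasFDerivAt (fun w : E2 => join (w, a)) (join.comp (ContinuousLinearMap.inl ℝ E2 E2)) 0 :=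
    join.hasFDerivAt.comp (0 : E2) ((hasFDerivAt_id (0 : E2)).prodMk (hasFDerivAt_const a (0 : E2)))
  have h := hasFDerivAt_tubeScale_zero.smul hj
  have hz : (0 : E2 →L[ℝ] ℝ).smulRight (join ((0 : E2), a)) = 0 := by
    ext v i
    simp
  rw [tubeScale_zero, one_smul, hz, add_zero] at h
  exact h

/-- **The meridional frame read ambiently**: `D (∂_h tube(x, ·)|₀) = (h, 0)`. [folklore] -/
theorem D_mfderiv_tube_vertical (x : S1) (h : E2) :
    D (tube (x, 0)) (mfderiv ((𝓡 1).prod 𝓘(ℝ, E2)) (𝓡 3) tube (x, 0) (0, h)) = join (h, 0) := by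
  have hd : HasMFDerivAt 𝓘(ℝ, E2) ((𝓡 1).prod 𝓘(ℝ, E2)) (fun w : E2 => (x, w)) 0
      ((0 : E2 →L[ℝ] E1).prod (ContinuousLinearMap.id ℝ E2)) :=
    (hasMFDerivAt_const x (0 : E2)).prodMk (hasMFDerivAt_id (0 : E2))
  have htd : HasMFDerivAt 𝓘(ℝ, E2) (𝓡 3) (tube ∘ fun w : E2 => (x, w)) 0
      ((mfderiv ((𝓡 1).prod 𝓘(ℝ, E2)) (𝓡 3) tube (x, 0)).comp
        ((0 : E2 →L[ℝ] E1).prod (ContinuousLinearMap.id ℝ E2))) :=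
    (mdifferentiableAt_tube (x, 0)).hasMFDerivAt.comp (0 : E2) hd
  have hvtd := (hasMFDerivAt_val (tube (x, 0))).comp (0 : E2) htd
  have hlin : HasMFDerivAt 𝓘(ℝ, E2) 𝓘(ℝ, E4) (fun w : E2 => tubeAmb ((x : E2), w)) 0
      (join.comp (ContinuousLinearMap.inl ℝ E2 E2)) :=
    hasMFDerivAt_iff_hasFDerivAt.2 (hasFDerivAt_tubeAmb_vertical (x : E2))
  have heq : (Subtype.val : S3 → E4) ∘ (tube ∘ fun w : E2 => (x, w)) =
      fun w : E2 => tubeAmb ((x : E2), w) := rfl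
  rw [heq] at hvtd
  exact congrArg (fun L : E2 →L[ℝ] E4 => L h) (hvtd.mfderiv.symm.trans hlin.mfderiv)

/-! ### The standard open book of `S³` -/

/-- The binding meets the tube exactly in its core. [folklore] -/
theorem tube_eq_core_imp (x x' : S1) (w : E2) (h : tube (x, w) = tube (x', 0)) : w = 0 := by
  have h' := congrArg (fun z : S3 => pr₁ (z : E4)) h
  simp only [pr₁_tube, smul_zero] at h'
  exact (smul_eq_zero.1 h').resolve_left (tubeScale_pos w).ne'

/-- The ambient vector `(-y₁, y₀, 0, 0)` (rotation of `z₁`), tangent to `S³` at `y`. [folklore] -/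
def rotVec (y : E4) : E4 := join (!₂[-(y 1), y 0], 0)

theorem inner_rotVec (y : E4) : ⟪y, rotVec y⟫ = 0 := by
  rw [inner_eq_sum, rotVec]
  simp
  ring

/-- **`π` is a submersion off the binding**: `dθ_y ≠ 0` for `z₁(y) ≠ 0` (it takes the value `1`
on the rotation vector `(-y₁, y₀, 0, 0)`). [folklore] -/
theorem angularDeriv_proj_ne_zero {y : S3} (hy : pr₁ (y : E4) ≠ 0) : angularDeriv proj y ≠ 0 := by
  obtain ⟨n, hn⟩ := exists_D_eq y (inner_rotVec (y : E4))
  have hr : 0 < ‖pr₁ (y : E4)‖ ^ 2 := by positivity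
  rw [norm_sq_eq₂] at hr
  simp only [pr₁_apply_zero, pr₁_apply_one] at hr
  have h1 : angularDeriv proj y n = 1 := by
    rw [angularDeriv_proj hy, hn, rotVec, norm_sq_eq₂]
    simp only [join_apply_zero, join_apply_one, pr₁_apply_zero, pr₁_apply_one]
    simp only [Matrix.cons_val_zero, Matrix.cons_val_one]
    rw [mul_neg, sub_neg_eq_add, inv_mul_cancel₀ hr.ne']
  intro h0
  rw [h0] at h1
  exact zero_ne_one h1

/-- **THE STANDARD (DISC) OPEN BOOK OF `S³`**: one binding circle `{z₁ = 0}` with its tube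
`(p, w) ↦ (w, p)/√(1 + ‖w‖²)`, fibration `π = z₁/‖z₁‖`, pages the open discs
`{z₁ ∈ ℝ₊ c}` (Etnyre 2006, Example after Def. 2.1; Wendl 2020, Fig. 5.1). [folklore] -/
def stdOpenBook : OpenBook S3 where
  k := 1
  k_pos := one_pos
  tube := fun _ => tube
  proj := proj
  isSmoothEmbedding_tube := fun _ => isSmoothEmbedding_tube
  isOpen_range_tube := fun _ => isOpen_range_tube
  eq_zero_of_tube_eq := fun _ _ x x' w h => tube_eq_core_imp x x' w h
  proj_tube := fun _ x _ hw => coe_proj_tube x hw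
  contMDiffOn_proj := by
    rw [tubesBinding_eq]
    exact contMDiffOn_proj
  angularDeriv_ne_zero := fun y hy => by
    rw [tubesBinding_eq] at hy
    exact angularDeriv_proj_ne_zero hy

/-- The binding of the standard open book is `{z₁ = 0}`. [folklore] -/
theorem binding_stdOpenBook : stdOpenBook.binding = {z : S3 | pr₁ (z : E4) = 0} :=
  tubesBinding_eq

theorem not_mem_binding_iff (y : S3) : y ∉ stdOpenBook.binding ↔ pr₁ (y : E4) ≠ 0 := by
  rw [binding_stdOpenBook]
  rfl

/-! ### Planarity: each page injects continuously into `S²` -/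

/-- The inner product on `ℝ³` in coordinates. [folklore] -/
theorem inner_eq_sum₃ (a b : E3) : ⟪a, b⟫ = a 0 * b 0 + a 1 * b 1 + a 2 * b 2 := by
  simp [PiLp.inner_apply, Fin.sum_univ_three, mul_comm]

theorem norm_sq_eq₃ (a : E3) : ‖a‖ ^ 2 = a 0 * a 0 + a 1 * a 1 + a 2 * a 2 := by
  rw [← inner_eq_sum₃, real_inner_self_eq_norm_sq]

/-- The page map `z ↦ (x₂, x₃, ‖z₁‖)` lands in `S²`. [folklore] -/
theorem pageMap_mem (z : S3) :
    (!₂[(z : E4) 2, (z : E4) 3, ‖pr₁ (z : E4)‖] : E3) ∈ Metric.sphere (0 : E3) 1 := by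
  rw [mem_sphere_zero_iff_norm]
  have h1 := norm_sq_pr_add z
  rw [norm_sq_eq₂ (pr₂ (z : E4))] at h1
  simp only [pr₂_apply_zero, pr₂_apply_one] at h1
  have h : ‖(!₂[(z : E4) 2, (z : E4) 3, ‖pr₁ (z : E4)‖] : E3)‖ ^ 2 = 1 := by
    rw [norm_sq_eq₃]
    have e0 : (!₂[(z : E4) 2, (z : E4) 3, ‖pr₁ (z : E4)‖] : E3) 0 = (z : E4) 2 := rfl
    have e1 : (!₂[(z : E4) 2, (z : E4) 3, ‖pr₁ (z : E4)‖] : E3) 1 = (z : E4) 3 := rfl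
    have e2 : (!₂[(z : E4) 2, (z : E4) 3, ‖pr₁ (z : E4)‖] : E3) 2 = ‖pr₁ (z : E4)‖ := rfl
    rw [e0, e1, e2]
    nlinarith [h1]
  exact (pow_eq_one_iff_of_nonneg (norm_nonneg _) two_ne_zero).1 h

/-- **The page map `S³ → S²`, `z ↦ (z₂, ‖z₁‖)`** (injective on each page `{arg z₁ = c}`).
[folklore] -/
def pageMap (z : S3) : Metric.sphere (0 : E3) 1 :=
  ⟨!₂[(z : E4) 2, (z : E4) 3, ‖pr₁ (z : E4)‖], pageMap_mem z⟩

theorem continuous_pageMap : Continuous pageMap := by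
  refine Continuous.subtype_mk ?_ _
  have h : Continuous fun z : S3 => (z : E4) := continuous_subtype_val
  refine (PiLp.continuous_toLp 2 _).comp ?_
  refine continuous_pi fun i => ?_
  fin_cases i
  · exact (continuous_apply 2).comp ((PiLp.continuous_ofLp 2 _).comp h)
  · exact (continuous_apply 3).comp ((PiLp.continuous_ofLp 2 _).comp h)
  · exact continuous_norm.comp (pr₁.continuous.comp h)

/-- On a page, `z₁` is recovered from `‖z₁‖` and the page angle. [folklore] -/
theorem pr₁_eq_of_page {c : S1} {z : S3} (hz : z ∈ stdOpenBook.page c) :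
    pr₁ (z : E4) = ‖pr₁ (z : E4)‖ • (c : E2) := by
  obtain ⟨hb, hc⟩ := hz
  rw [not_mem_binding_iff] at hb
  have hc' : ((proj z : S1) : E2) = (c : E2) := by rw [← hc]; rfl
  rw [proj, RotationBody.coe_sphN hb] at hc'
  rw [← hc', smul_smul, mul_inv_cancel₀ (norm_ne_zero_iff.2 hb), one_smul]

/-- **The standard open book is planar**: `z ↦ (z₂, ‖z₁‖)` is a continuous injection of each
page into `S²`. [folklore] -/
theorem isPlanar_stdOpenBook : stdOpenBook.IsPlanar := by
  intro c
  refine ⟨fun z => pageMap z.1, continuous_pageMap.comp continuous_subtype_val, ?_⟩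
  rintro ⟨z, hz⟩ ⟨z', hz'⟩ h
  have h0 := congrArg (fun q : Metric.sphere (0 : E3) 1 => (q : E3)) h
  simp only [pageMap] at h0
  have h2 : (z : E4) 2 = (z' : E4) 2 := by simpa using congrArg (fun a : E3 => a 0) h0
  have h3 : (z : E4) 3 = (z' : E4) 3 := by simpa using congrArg (fun a : E3 => a 1) h0
  have hn : ‖pr₁ (z : E4)‖ = ‖pr₁ (z' : E4)‖ := by simpa using congrArg (fun a : E3 => a 2) h0
  have h1 : pr₁ (z : E4) = pr₁ (z' : E4) := by
    rw [pr₁_eq_of_page hz, pr₁_eq_of_page hz', hn]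
  apply Subtype.ext
  apply Subtype.ext
  rw [← join_pr (z : E4), ← join_pr (z' : E4), h1]
  congr 2
  ext i
  fin_cases i
  · exact h2
  · exact h3

/-! ### The Giroux conditions -/

/-- Chain rule through the inclusion `𝔻⁴ ↪ ℝ⁴` (as in the tree's
`closedBallCoeDeriv_mfderiv_apply`, restated to keep the imports light). [folklore] -/
theorem closedBallCoeDeriv_mfderiv_incl (y : S3) (v : E3) :
    closedBallCoeDeriv ((closedBallBoundaryData 3).incl y)
        (mfderiv (𝓡 3) (𝓡∂ 4) (closedBallBoundaryData 3).incl y v) = D y v := by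
  have hf : MDifferentiableAt (𝓡 3) (𝓡∂ 4) (closedBallBoundaryData 3).incl y :=
    ((closedBallBoundaryData 3).isSmoothEmbedding.contMDiff y).mdifferentiableAt (by simp)
  have hval : MDifferentiableAt (𝓡∂ 4) 𝓘(ℝ, E4) (Subtype.val : 𝔻⁴ → E4)
      ((closedBallBoundaryData 3).incl y) :=
    (contMDiff_coe_closedBall (n := 3) _).mdifferentiableAt (by simp)
  have h := mfderiv_comp y hval hf
  rw [mfderiv_coe_closedBall] at h
  have h2 := congrArg (fun L : E3 →L[ℝ] E4 => L v) h
  exact h2.symm.trans rfl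

/-- **The complex tangencies of `∂𝔻⁴`, pulled back to `S³`, are `ker α`**:
`v ∈ ξ_y ↔ ⟪J₀ y, D_y v⟫ = 0`. [folklore] -/
theorem mem_planeField_iff (y : S3) (v : E3) :
    v ∈ boundaryPlaneField steinStructureClosedBall.J (closedBallBoundaryData 3) y ↔
      ⟪J₀ (y : E4), D y v⟫ = 0 := by
  have hx : ‖(((closedBallBoundaryData 3).incl y : 𝔻⁴) : E4)‖ = 1 := norm_eq_of_mem_sphere y
  rw [mem_boundaryPlaneField_iff]
  have e := closedBallCoeDeriv_mfderiv_incl y v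
  have key := mem_contactPlane_steinStructureClosedBall_iff (x := (closedBallBoundaryData 3).incl y) hx
    (mfderiv (𝓡 3) (𝓡∂ 4) (closedBallBoundaryData 3).incl y v)
  refine key.trans ?_
  rw [e]
  exact ⟨fun h => h.2, fun h => ⟨inner_D y v, h⟩⟩

/-- `ker α = ξ`. [folklore] -/
theorem girouxForm_eq_zero_iff (y : S3) (v : E3) :
    girouxForm y ![v] = 0 ↔
      v ∈ boundaryPlaneField steinStructureClosedBall.J (closedBallBoundaryData 3) y := by
  rw [girouxForm_apply, mem_planeField_iff]

/-- `α_y` typed over the chart model `ℝ³` (the same term). [folklore] -/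
def αE (y : S3) : E3 [⋀^Fin 1]→L[ℝ] ℝ := girouxForm y

/-- `(dα)_y` typed over the chart model `ℝ³` (the same term). [folklore] -/
def dαE (y : S3) : E3 [⋀^Fin 2]→L[ℝ] ℝ := mextDeriv girouxForm y

theorem αE_apply (y : S3) (v : E3) : αE y ![v] = ⟪J₀ (y : E4), D y v⟫ := girouxForm_apply y v

theorem dαE_apply (y : S3) (u v : E3) : dαE y ![u, v] = 2 * ⟪J₀ (D y u), D y v⟫ :=
  mextDeriv_girouxForm_apply y u v

/-- `(α ∧ dα)(u, v, w)` in terms of the ambient tangent vectors. [folklore] -/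
theorem wedge_girouxForm (y : S3) (u v w : E3) :
    wedge₁₂ (girouxForm y) (mextDeriv girouxForm y) u v w =
      ⟪J₀ (y : E4), D y u⟫ * (2 * ⟪J₀ (D y v), D y w⟫) -
        ⟪J₀ (y : E4), D y v⟫ * (2 * ⟪J₀ (D y u), D y w⟫) +
          ⟪J₀ (y : E4), D y w⟫ * (2 * ⟪J₀ (D y u), D y v⟫) := by
  show αE y ![u] * dαE y ![v, w] - αE y ![v] * dαE y ![u, w] + αE y ![w] * dαE y ![u, v] = _
  rw [αE_apply, αE_apply, αE_apply, dαE_apply, dαE_apply, dαE_apply]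

/-- The second ambient test vector `K y = (-y₂, y₃, y₀, -y₁)` (a second complex structure). -/
def kVec (y : E4) : E4 := !₂[-(y 2), y 3, y 0, -(y 1)]

/-- The three test vectors are tangent to the sphere. [folklore] -/
theorem inner_test_vectors (y : E4) :
    ⟪y, J₀ y⟫ = 0 ∧ ⟪y, kVec y⟫ = 0 ∧ ⟪y, J₀ (kVec y)⟫ = 0 := by
  refine ⟨?_, ?_, ?_⟩ <;>
  · rw [inner_eq_sum]
    simp [kVec]
    ring

/-- **`α` is a contact form**: `(α ∧ dα)(J₀y, Ky, J₀Ky) = 2‖y‖⁴ = 2 ≠ 0`. [folklore] -/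
theorem contact_girouxForm (y : S3) :
    ∃ u v w : E3, wedge₁₂ (girouxForm y) (mextDeriv girouxForm y) u v w ≠ 0 := by
  have hy : ‖(y : E4)‖ ^ 2 = 1 := by rw [norm_eq_of_mem_sphere y, one_pow]
  rw [norm_sq_eq₄] at hy
  obtain ⟨h1, h2, h3⟩ := inner_test_vectors (y : E4)
  obtain ⟨u, hu⟩ := exists_D_eq y h1
  obtain ⟨v, hv⟩ := exists_D_eq y h2
  obtain ⟨w, hw⟩ := exists_D_eq y h3
  refine ⟨u, v, w, ?_⟩
  rw [wedge_girouxForm, hu, hv, hw]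
  simp only [inner_J_eq]
  simp only [kVec, stdComplexStructure_apply_zero, stdComplexStructure_apply_one,
    stdComplexStructure_apply_two, stdComplexStructure_apply_three]
  simp
  nlinarith [hy]

/-- **THE PAGE CONDITION, algebraic core.**  With `c(X) = y₀X₁ - y₁X₀` (`‖z₁‖² dθ`),
`A(X) = ⟪J₀ y, X⟫`, `Ω(X, Y) = 2⟪J₀ X, Y⟫`: for `U, V` tangent to the page (`⊥ y`, `c = 0`) and any
tangent `N` with `c(N) > 0`, `(A ∧ Ω)(N, U, V) > 0` forces `Ω(U, V) > 0` — because
`‖z₁‖² · (A ∧ Ω)(N, U, V) = Ω(U, V) · c(N)` on the constraint set (an explicit polynomial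
identity, checked by `linear_combination`). [folklore] -/
theorem pages_algebra (y0 y1 y2 y3 N0 N1 N2 N3 U0 U1 U2 U3 V0 V1 V2 V3 : ℝ)
    (hy : y0 * y0 + y1 * y1 + y2 * y2 + y3 * y3 = 1)
    (hU : y0 * U0 + y1 * U1 + y2 * U2 + y3 * U3 = 0)
    (hV : y0 * V0 + y1 * V1 + y2 * V2 + y3 * V3 = 0)
    (hcU : y0 * U1 - y1 * U0 = 0) (hcV : y0 * V1 - y1 * V0 = 0)
    (hr : 0 < y0 * y0 + y1 * y1) (hcN : 0 < y0 * N1 - y1 * N0)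
    (hW : 0 < (y0 * N1 - y1 * N0 + y2 * N3 - y3 * N2) * (2 * (U0 * V1 - U1 * V0 + U2 * V3 - U3 * V2)) -
      (y0 * U1 - y1 * U0 + y2 * U3 - y3 * U2) * (2 * (N0 * V1 - N1 * V0 + N2 * V3 - N3 * V2)) +
      (y0 * V1 - y1 * V0 + y2 * V3 - y3 * V2) * (2 * (N0 * U1 - N1 * U0 + N2 * U3 - N3 * U2))) :
    0 < 2 * (U0 * V1 - U1 * V0 + U2 * V3 - U3 * V2) := by
  -- `‖z₁‖² · W = 2 c(N) q(U,V)` on the constraint set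
  have key : (y0 * y0 + y1 * y1) *
      ((y0 * N1 - y1 * N0 + y2 * N3 - y3 * N2) * (2 * (U0 * V1 - U1 * V0 + U2 * V3 - U3 * V2)) -
      (y0 * U1 - y1 * U0 + y2 * U3 - y3 * U2) * (2 * (N0 * V1 - N1 * V0 + N2 * V3 - N3 * V2)) +
      (y0 * V1 - y1 * V0 + y2 * V3 - y3 * V2) * (2 * (N0 * U1 - N1 * U0 + N2 * U3 - N3 * U2))) =
      2 * (y0 * N1 - y1 * N0) * (U2 * V3 - U3 * V2) := by
    linear_combination (2 * (y0 * N1 - y1 * N0) * (U2 * V3 - U3 * V2)) * hy +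
      (2 * (y0 * N1 - y1 * N0) * (y2 * U3 - y3 * U2)) * hV -
      (2 * (y0 * N1 - y1 * N0) * (y2 * V3 - y3 * V2)) * hU +
      (2 * ((y2 * N3 - y3 * N2) * (y0 * U0 + y1 * U1) - (y2 * U3 - y3 * U2) * (y0 * N0 + y1 * N1) +
        (y0 * y0 + y1 * y1) * (N2 * U3 - N3 * U2))) * hcV +
      (2 * (-(y2 * N3 - y3 * N2) * (y0 * V0 + y1 * V1) + (y2 * V3 - y3 * V2) * (y0 * N0 + y1 * N1) -
        (y0 * y0 + y1 * y1) * (N2 * V3 - N3 * V2))) * hcU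
  -- the `z₁`-part of `Ω(U, V)` vanishes
  have hp : (y0 * y0 + y1 * y1) * (U0 * V1 - U1 * V0) = 0 := by
    linear_combination (y0 * U0 + y1 * U1) * hcV - (y0 * V0 + y1 * V1) * hcU
  have hp' : U0 * V1 - U1 * V0 = 0 := (mul_eq_zero.1 hp).resolve_left hr.ne'
  have hq : 0 < (y0 * N1 - y1 * N0) * (U2 * V3 - U3 * V2) := by nlinarith [mul_pos hr hW]
  have hq' : 0 < U2 * V3 - U3 * V2 := pos_of_mul_pos_right hq hcN.le
  nlinarith [hq', hp']

/-- **`dα > 0` on the pages.** [folklore] -/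
theorem pages_girouxForm (y : S3) (hyB : y ∉ stdOpenBook.binding) (n u v : E3)
    (hn : 0 < angularDeriv stdOpenBook.proj y n) (hu : angularDeriv stdOpenBook.proj y u = 0)
    (hv : angularDeriv stdOpenBook.proj y v = 0)
    (hW : 0 < wedge₁₂ (girouxForm y) (mextDeriv girouxForm y) n u v) :
    0 < mextDeriv girouxForm y ![u, v] := by
  rw [not_mem_binding_iff] at hyB
  have hr : 0 < ‖pr₁ (y : E4)‖ ^ 2 := by positivity
  change 0 < angularDeriv proj y n at hn
  change angularDeriv proj y u = 0 at hu
  change angularDeriv proj y v = 0 at hv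
  rw [angularDeriv_proj hyB] at hn hu hv
  have hcN : 0 < (y : E4) 0 * D y n 1 - (y : E4) 1 * D y n 0 :=
    (mul_pos_iff_of_pos_left (inv_pos.2 hr)).1 hn
  have hcU : (y : E4) 0 * D y u 1 - (y : E4) 1 * D y u 0 = 0 :=
    (mul_eq_zero.1 hu).resolve_left (inv_pos.2 hr).ne'
  have hcV : (y : E4) 0 * D y v 1 - (y : E4) 1 * D y v 0 = 0 :=
    (mul_eq_zero.1 hv).resolve_left (inv_pos.2 hr).ne'
  rw [wedge_girouxForm] at hW
  show 0 < dαE y ![u, v]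
  rw [dαE_apply]
  simp only [inner_J_eq] at hW ⊢
  have hy : ‖(y : E4)‖ ^ 2 = 1 := by rw [norm_eq_of_mem_sphere y, one_pow]
  rw [norm_sq_eq₄] at hy
  have hU := inner_D y u
  have hV := inner_D y v
  rw [inner_eq_sum] at hU hV
  rw [norm_sq_eq₂] at hr
  simp only [pr₁_apply_zero, pr₁_apply_one] at hr
  exact pages_algebra _ _ _ _ _ _ _ _ _ _ _ _ _ _ _ _ hy hU hV hcU hcV hr hcN hW

/-- The binding circle: `‖x‖² = 1` and `t ⊥ x`, `t ≠ 0` give `(x₀t₁ - x₁t₀)² = ‖t‖² > 0`. [folklore] -/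
theorem cross_sq_pos {x0 x1 t0 t1 : ℝ} (hx : x0 * x0 + x1 * x1 = 1) (ht : x0 * t0 + x1 * t1 = 0)
    (hpos : 0 < t0 * t0 + t1 * t1) : 0 < (x0 * t1 - x1 * t0) ^ 2 := by
  have h : (x0 * t1 - x1 * t0) ^ 2 = t0 * t0 + t1 * t1 := by
    linear_combination (t0 * t0 + t1 * t1) * hx - (x0 * t0 + x1 * t1) * ht
  rw [h]
  exact hpos

/-- **`α > 0` on the binding oriented as the boundary of the pages.** [folklore] -/
theorem binding_girouxForm (i : Fin stdOpenBook.k) (x : S1) :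
    0 < girouxForm (tube (x, 0)) ![stdOpenBook.coreTangent i x] *
      wedge₁₂ (girouxForm (tube (x, 0))) (mextDeriv girouxForm (tube (x, 0)))
        (stdOpenBook.coreTangent i x) (stdOpenBook.discFrame i x 0) (stdOpenBook.discFrame i x 1) := by
  set t : E2 := D₁ x (EuclideanSpace.single (0 : Fin 1) (1 : ℝ)) with ht_def
  have hB : D (tube (x, 0)) (stdOpenBook.coreTangent i x) = join (0, t) :=
    D_mfderiv_tube_horizontal x _
  have hE0 : D (tube (x, 0)) (stdOpenBook.discFrame i x 0) = join (EuclideanSpace.single 0 1, 0) :=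
    D_mfderiv_tube_vertical x _
  have hE1 : D (tube (x, 0)) (stdOpenBook.discFrame i x 1) = join (EuclideanSpace.single 1 1, 0) :=
    D_mfderiv_tube_vertical x _
  rw [wedge_girouxForm]
  show 0 < αE (tube (x, 0)) ![stdOpenBook.coreTangent i x] * _
  rw [αE_apply, hB, hE0, hE1, coe_tube_zero]
  -- everything in coordinates
  simp only [inner_J_eq]
  simp only [join_apply_zero, join_apply_one, join_apply_two, join_apply_three]
  have s00 : (EuclideanSpace.single (0 : Fin 2) (1 : ℝ)) 0 = 1 := by simp
  have s01 : (EuclideanSpace.single (0 : Fin 2) (1 : ℝ)) 1 = 0 := by simp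
  have s10 : (EuclideanSpace.single (1 : Fin 2) (1 : ℝ)) 0 = 0 := by simp
  have s11 : (EuclideanSpace.single (1 : Fin 2) (1 : ℝ)) 1 = 1 := by simp
  simp only [s00, s01, s10, s11, PiLp.zero_apply]
  -- the circle data
  have hx : (x : E2) 0 * (x : E2) 0 + (x : E2) 1 * (x : E2) 1 = 1 := by
    rw [← norm_sq_eq₂, norm_eq_of_mem_sphere x, one_pow]
  have hxt : (x : E2) 0 * t 0 + (x : E2) 1 * t 1 = 0 := by
    rw [← inner_eq_sum₂]
    exact inner_D₁ x _
  have ht0 : t ≠ 0 := by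
    intro h
    have h' : EuclideanSpace.single (0 : Fin 1) (1 : ℝ) = 0 :=
      D₁_injective x (by rw [← ht_def, h, map_zero])
    have := congrArg (fun w : E1 => w 0) h'
    simp at this
  have htpos : 0 < t 0 * t 0 + t 1 * t 1 := by
    rw [← norm_sq_eq₂]
    positivity
  have hc := cross_sq_pos hx hxt htpos
  nlinarith [hc]

/-- **`α` is a Giroux form for the standard open book and the complex tangencies of `∂𝔻⁴`.**
[folklore] -/
theorem isGirouxForm_stdOpenBook :
    stdOpenBook.IsGirouxForm
      (boundaryPlaneField steinStructureClosedBall.J (closedBallBoundaryData 3)) girouxForm where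
  smooth := isSmoothForm_girouxForm
  ker_eq := girouxForm_eq_zero_iff
  contact := contact_girouxForm
  pages := fun y hy n u v hn hu hv hW => pages_girouxForm y hy n u v hn hu hv hW
  binding := fun i x => binding_girouxForm i x

/-- The standard open book supports the complex tangencies of `∂𝔻⁴ = S³`. [folklore] -/
theorem supports_stdOpenBook :
    stdOpenBook.Supports (boundaryPlaneField steinStructureClosedBall.J (closedBallBoundaryData 3)) :=
  ⟨girouxForm, isGirouxForm_stdOpenBook⟩

end SphereOpenBook

/-- **GAP G1 CLOSED: the contact boundary `(S³, ξ_std)` of the standard Stein ball is PLANAR**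
— the disc open book `B = {z₁ = 0}`, `π = z₁/‖z₁‖` of `S³ = ∂𝔻⁴` supports the complex
tangencies of `steinStructureClosedBall` (Etnyre 2006, Example after Def. 2.1; Wendl 2020,
Fig. 5.1), with the Giroux form `α = ⟪J₀ z, ·⟫|_{S³}`; first inhabitant of the tree's
`OpenBook`/`Supports`/`IsPlanar`/`PlanarContactBoundary` interface. [folklore] -/
theorem planarContactBoundary_steinStructureClosedBall :
    PlanarContactBoundary steinStructureClosedBall :=
  ⟨closedBallBoundaryData 3, SphereOpenBook.stdOpenBook, SphereOpenBook.isPlanar_stdOpenBook,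
    SphereOpenBook.supports_stdOpenBook⟩

/-- **Gap G1 CLOSED**: the standard Stein ball's contact boundary `(S³, ξ_std)` is planar
(the disc open book supports it; §5a). [folklore] -/
theorem planarContactBoundary_steinBall : PlanarContactBoundary steinStructureClosedBall :=
  planarContactBoundary_steinStructureClosedBall

/-- **NON-VACUITY (unconditional): the round `S⁴` carries a planar Stein bisection along a
common contact seam** (hemispheres = two standard Stein balls, sibling `crux_hypotheses_at_sphere`;
planarity of `(S³, ξ_std)` = §5a). [folklore] -/
theorem hasPlanarSteinBisection_sphere : HasPlanarSteinBisection 𝕊⁴ := by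
  obtain ⟨e₁, e₂, h1, h2, h3, h4, h5, h6⟩ := crux_hypotheses_at_sphere
  exact ⟨⟨𝔻⁴, 𝔻⁴, steinStructureClosedBall, steinStructureClosedBall, e₁, e₂, h1, h2, h3, h4, h5, h6⟩,
    planarContactBoundary_steinBall⟩

/-- Planar witnesses transport along diffeomorphisms (the halves do not change). [folklore] -/
theorem hasPlanarSteinBisection_of_diffeomorph {M N : Type} [TopologicalSpace M] [ChartedSpace 𝔼4 M]
    [IsManifold (𝓡 4) ∞ M] [TopologicalSpace N] [ChartedSpace 𝔼4 N] [IsManifold (𝓡 4) ∞ N]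
    (Φ : N ≃ₘ⟮𝓡 4, 𝓡 4⟯ M) (h : HasPlanarSteinBisection N) : HasPlanarSteinBisection M := by
  obtain ⟨B, hB⟩ := h
  exact ⟨B.transport Φ, hB⟩

/-- **TIGHTNESS (unconditional)**: under `SmoothPoincare4` every `M ≃ₕ S⁴` satisfies the full
hypothesis of the crux, so `SmoothPoincare4 ↔ (PBR ∧ every homotopy sphere carries a planar Stein
bisection)` carries no slack (`smoothPoincare4_iff_pbr`). [folklore] -/
theorem hasPlanarSteinBisection_of_smoothPoincare4
    (hs : _root_.SmoothPoincare4) (M : Type) [TopologicalSpace M] [T2Space M]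
    [SecondCountableTopology M] [ChartedSpace 𝔼4 M] [IsManifold (𝓡 4) ∞ M] (e : M ≃ₕ 𝕊⁴) :
    HasPlanarSteinBisection M := by
  obtain ⟨Φ⟩ := hs M ‹_› ‹_› e
  exact hasPlanarSteinBisection_of_diffeomorph Φ.symm hasPlanarSteinBisection_sphere

/-- **No slack between the crux and the summit**: `SmoothPoincare4 ↔ PBR ∧ every homotopy
4-sphere carries a planar Stein bisection along a common contact seam`. [folklore] -/
theorem smoothPoincare4_iff_pbr :
    _root_.SmoothPoincare4 ↔
      PlanarBisectionRigidity ∧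
        ∀ (M : Type) [TopologicalSpace M] [T2Space M] [SecondCountableTopology M]
          [ChartedSpace 𝔼4 M] [IsManifold (𝓡 4) ∞ M], M ≃ₕ 𝕊⁴ → HasPlanarSteinBisection M := by
  constructor
  · intro hs
    exact ⟨of_smoothPoincare4 hs, fun M _ _ _ _ _ e => hasPlanarSteinBisection_of_smoothPoincare4 hs M e⟩
  · rintro ⟨hR, hE⟩ M _ _ _ _ _ e
    exact (planarBisectionRigidity_iff.1 hR) M e (hE M e)

/-- The seam of the hemisphere bisection of `S⁴` is connected (it is the image of `∂𝔻⁴ = S³`).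
[folklore] -/
theorem isConnected_image_boundary_closedBall {M : Type} [TopologicalSpace M]
    {e₁ : 𝔻⁴ → M} (he : Continuous e₁) : IsConnected (e₁ '' (𝓡∂ 4).boundary 𝔻⁴) := by
  have hb : (𝓡∂ 4).boundary 𝔻⁴ = range (closedBallBoundaryData 3).incl :=
    (closedBallBoundaryData 3).range_incl.symm
  rw [hb, ← range_comp]
  haveI : ConnectedSpace (closedBallBoundaryData 3).carrier := by
    show ConnectedSpace (Metric.sphere (0 : 𝔼4) 1)
    exact isConnected_iff_connectedSpace.1
      (isConnected_sphere (by
        rw [← Module.finrank_eq_rank, finrank_euclideanSpace, Fintype.card_fin]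
        exact_mod_cast (by norm_num : (1 : ℕ) < 4)) (0 : 𝔼4) zero_le_one)
  exact isConnected_range (he.comp (closedBallBoundaryData 3).continuous_incl)

/-- **Support item 10512 ⇐ summit (unconditional)**: `SmoothPoincare4 → PlanarBisectionExists`
(transport the planar hemisphere bisection of `S⁴`; its seam `S³` is connected). So the existence
support item cannot fail without an exotic sphere either. [folklore] -/
theorem planarBisectionExists_of_smoothPoincare4
    (hs : _root_.SmoothPoincare4) : PlanarBisectionExists := by
  intro M _ _ _ _ _ e
  obtain ⟨Φ⟩ := hs M ‹_› ‹_› e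
  obtain ⟨e₁, e₂, h1, h2, h3, h4, h5, h6⟩ := crux_hypotheses_at_sphere
  let B : Witness 𝕊⁴ :=
    ⟨𝔻⁴, 𝔻⁴, steinStructureClosedBall, steinStructureClosedBall, e₁, e₂, h1, h2, h3, h4, h5, h6⟩
  let B' : Witness M := B.transport Φ.symm
  refine ⟨B'.W₁, inferInstance, inferInstance, inferInstance, inferInstance, B'.W₂, inferInstance,
    inferInstance, inferInstance, inferInstance, B'.J₁, B'.J₂, B'.e₁, B'.e₂, B'.emb₁, B'.emb₂, B'.cover,
    B'.inter₁, B'.inter₂, B'.contact, planarContactBoundary_steinBall, ?_⟩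
  rw [B'.inter₁]
  show IsConnected ((Φ.symm ∘ e₁) '' (𝓡∂ 4).boundary 𝔻⁴)
  exact isConnected_image_boundary_closedBall (Φ.symm.continuous.comp h1.isEmbedding.continuous)

/-- **The support item `PlanarBisectionExists` cannot fail without an exotic `S⁴`.** [folklore] -/
theorem not_smoothPoincare4_of_not_planarBisectionExists (h : ¬ PlanarBisectionExists) :
    ¬ _root_.SmoothPoincare4 :=
  fun hs => h (planarBisectionExists_of_smoothPoincare4 hs)

/-! ## §6 Strengthenings refuted on paper (recorded; formal versions modulo explicit inputs) -/

/-- **Strengthening "the seam is `S³`"** (equivalently, with Eliashberg, "both halves are `B⁴`"):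
a homotopy 4-sphere with a planar Stein bisection has seam homeomorphic to `S³`. [folklore] -/
def SeamIsSphere : Prop :=
  ∀ (M : Type) [TopologicalSpace M] [T2Space M] [SecondCountableTopology M]
    [ChartedSpace 𝔼4 M] [IsManifold (𝓡 4) ∞ M], M ≃ₕ 𝕊⁴ → ∀ B : Witness M, Planar B →
    Nonempty (((𝓡∂ 4).boundary B.W₁) ≃ₜ Metric.sphere (0 : 𝔼4) 1)

/-- **Input for the formal refutation of `SeamIsSphere`**: a CONTRACTIBLE planar compact Stein
domain whose boundary is not `S³` and whose double is `S⁴`. TRUE on paper: the Akbulut–Mazur cork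
`C` (`S⁴ = D(C)` since `C × I ≅ B⁵`, Mazur), with the planar Stein structure of
Karakurt–Oba–Ukida (arXiv:1607.07661 Prop 2.3: PALF with page the 4-holed disc, monodromy
`t_a t_b t_c t_d`) or Oba's Mazur-type planar fillings (arXiv:1405.3751 Thm 1.1); `∂C` is the
Brieskorn-like ℤHS³ `Σ(2,5,7)`-cousin `∂W⁻(0,0)`, not `S³` (`π₁ ≠ 1`). Not constructible in the
tree (no cork with a Stein structure, no open book). [cite: arXiv:1607.07661, Prop. 2.3] -/
def ExistsPlanarCorkDoubleSphere : Prop :=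
  ∃ B : Witness 𝕊⁴, Planar B ∧ IsEmpty (((𝓡∂ 4).boundary B.W₁) ≃ₜ Metric.sphere (0 : 𝔼4) 1)

/-- `SeamIsSphere` is false as soon as the planar cork double of `S⁴` is available. [folklore] -/
theorem seamIsSphere_false_of (h : ExistsPlanarCorkDoubleSphere) : ¬ SeamIsSphere := by
  rintro hS
  obtain ⟨B, hB, hne⟩ := h
  exact not_nonempty_iff.2 hne (hS 𝕊⁴ (ContinuousMap.HomotopyEquiv.refl _) B hB)

/-! ## §7 Wendl normal form; the smallest open instances; the `k = 4` layer = reflection twins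

Documentation for the provers (no Lefschetz vocabulary exists in the tree, gap G3) plus two
machine-checked algebraic facts (`twin_identity`, `twin_identity'`). Notation: `P_k` = sphere
with `k ≥ 1` holes = disc `D_n` with `n = k − 1` holes; `Mod(D_n, ∂)` (all boundary fixed) is the
framed pure braid group `PB_n × ℤⁿ`; an element is encoded faithfully by its ARC DATA
`a_i(φ) = φ(γ_i)·γ_i⁻¹ ∈ F_n` (Alexander method; `γ_i` = arc from the outer boundary to hole `i`),
see `census2.py` (evidence; conventions validated on the exact lantern relation).

* WENDL (arXiv:0806.3193 Thm 1) + ETNYRE: a planar witness over `M ≃ₕ S⁴` has `Wᵢ ≅ X_{Fᵢ}`,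
  planar Lefschetz fibrations over `D²` with fibre `P_k` over ONE open book `(P_k, φ)` of the seam;
  ℚ-acyclic ⇔ `#Fᵢ = n` and the hole-incidence vectors of the cycles span `ℚⁿ`
  (`|det| = |H₁(X_F)|`). Hence `M ≅ Σ(F, F') := X_F ∪_id X̄_{F'}` (modulo `Aut(P_k, φ)`).
  Read off the arc data: `π₁(X_F) = F_n/⟪w(cᵢ)⟫`, `π₁(seam) = F_n/⟪a_i(φ)⟫`,
  `π₁(Σ(F,F')) = F_n/⟪w(cᵢ), w(c'ⱼ)⟫` (= `π₁(V)` below).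
* HANDLES: `Σ(F,F') = [n 1-handles ∪ n 2-handles (cᵢ, pf − 1)] ∪ [n 2-handles (c'ⱼ, pf + 1) on
  pages of ∂X_F] ∪ [n 3-handles] ∪ [4-handle]`; by Laudenbach–Poénaru
  `Σ(F,F') ≅ S⁴ ⇔ V(F,F') := X_F ∪ {(c'ⱼ, pf+1)} ≅ ♮ⁿ(S² × D²)`. A boundary-parallel inner cycle
  `∂_m` is a meridian of the `m`-th dotted circle with framing `±1` and CANCELS that 1-handle; a
  COMMON factor `c` of `F` and `F'` placed on cyclically adjacent pages (the `F'`-handles follow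
  the `F`-handles in REVERSED order, as in a double) lets `c₊` slide over `c₋` to a `0`-framed
  MERIDIAN of `c₋` (exactly the double's picture `D(X) = X ∪ {0-framed meridians} ∪ 3,4-handles`);
  equivalently `Σ(F,F')` is the circle surgery of `Σ(F∖c, F'∖c)` along `c` (`h_c ∪ h̄_c = D² × S²`).
  (An earlier draft's "`0`-framed split unknot, `V ≅ (S² × D²) ♮ V₀`" was WRONG: the two pushoffs
  have different linking with `c₋`.)
* SECTIONS: `Σ(F,F') ∖ (binding, k circles)` is an achiral `P_k`-Lefschetz fibration over
  `S² = D² ∪ D̄²`; capping the holes, `Σ(F,F')` = surgery on `k` disjoint square-0 SECTIONS of an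
  achiral genus-0 Lefschetz fibration `Z → S²` (`n` positive, `n` negative critical points,
  `Z ≅ (S²-bundle) # nℂℙ² # nℂℙ²-bar`); so `Σ(F,F') # k·(S²-bundles)` is standard (stably standard;
  cf. Barriers/StableInvariantsBlind). (Prior art for "closed 4-manifold ∖ circles = achiral LF
  over S²": Etnyre–Fuller 2006.)
* `k ≤ 3`: `Mod(P_k, ∂)` abelian, positive factorisations unique up to order ⇒ `Σ = D(X_F)`,
  `X_F × I ≅ B⁵` ⇒ `Σ ≅ S⁴`. KNOWN.
* `k = 4` (page `D₃`; `Mod(D₃, ∂) = PB₃ × ℤ³`, `PB₃ = ⟨A₁₂, A₂₃⟩ × ⟨Δ²⟩`, `⟨A₁₂, A₂₃⟩ ≅ F₂` free on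
  the round twists `x = T₁₂`, `y = T₂₃`). REDUCTION (gen 2, exact): (a) a homotopy-sphere pair has
  `det = ±1` (the `det = 2` type `{a,b,c}` leaves `H₁(Σ) ⊇ ℤ/2`), hence each factorisation is
  `(d, t_a, t_b)` with `d` CENTRAL (an inner boundary twist `dᵢ` or the outer `d_out`) and `a, b`
  essential of two different hole types; the framing vector and the abelianisation of `PB₃` force
  `F'` to have the same `d` and the same types; (b) Hurwitz moves commute past `d`, so
  `(d,t_a,t_b) ∼ (d,t_{a'},t_{b'})` iff the `F₂`-images `(u,v) = (x^g, y^h)`, `(u',v')` (conjugates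
  of `x`, `y` with `uv = u'v' = w`) are SIMULTANEOUSLY CONJUGATE BY A POWER OF `w`.
  CENSUS OF THE `F₂` PROBLEM (evidence `f2pairs/`: `f2pairs.py`, `twins.py`, `k4frontier.py`): over
  all conjugators of length `≤ 6` (286 elements `w` with two classes; 27 / 90 at length `≤ 4 / 5`):
  EVERY `w` with more than one class has EXACTLY TWO, is reverse-symmetric (`r(w) ∼ w⁻¹` for the
  reflection `r : x ↦ x⁻¹, y ↦ y⁻¹` of the pants), and the second class is the REFLECTION TWIN
  `(u,v) ↦ c·(r(v)⁻¹ r(u)⁻¹ r(v), r(v)⁻¹)·c⁻¹` (`c r(w)⁻¹ c⁻¹ = w`) of the first; no exception, no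
  third class. Smallest twin: `w = y⁻¹xyx⁻¹yx = x · (x⁻¹y⁻¹x) y (x⁻¹y⁻¹x)⁻¹ = (y⁻¹xy)(x⁻¹yx)`
  (`twin_identity` below), i.e. `t_{r₁₂} t_{β(r₂₃)} = t_{T₂₃⁻¹(r₁₂)} t_{T₁₂⁻¹(r₂₃)}` in `Mod(D₃, ∂)`,
  `β = T₁₂⁻¹T₂₃⁻¹T₁₂` — two Hurwitz-INEQUIVALENT positive factorisations; with any central `d` both
  fillings are contractible, Tietze/AC-trivial, the seam is a ℤHS³ with a non-abelian `A₅`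
  representation (a planar Mazur-type cork boundary, cf. Oba 2015), and `π₁(Σ) = 1`
  (`k4frontier.py` output `k4_L4.jsonl`, all entries `exact_equal_in_ModD3 = true`).
  GEOMETRY OF A TWIN: `F^† := (r(c_n), …, r(c_1))` is a positive factorisation of
  `φ^† = r φ⁻¹ r⁻¹`, and `X_{F^†} ≅ X_F` as ORIENTED manifolds (reflect fibre and base); when
  `φ^† = c⁻¹ φ c` the twin `c F^† c⁻¹` is a second factorisation of `φ` and
  `Σ(F, twin F) ≅ X_F ∪_τ X̄_F`, `τ` the orientation-preserving, co-orientation-REVERSING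
  contactomorphism of `(∂X_F, ξ)` induced by `(reflection of pages) × (reversal of S¹)` composed
  with `c` (`−α` is again a Giroux form). CONSEQUENCE (conjectural only through the completeness of
  the twin census): THE WHOLE `k = 4` LAYER CONSISTS OF CORK TWISTS OF `S⁴ = D(X_F)` ALONG PLANAR
  MAZUR-TYPE CONTRACTIBLE FILLINGS `X_F` BY THEIR REFLECTION CONTACTOMORPHISM `τ` — the
  Akbulut-cork phenomenon (Karakurt–Oba–Ukida: two PALFs on the Akbulut cork related by the cork
  involution) in complete generality at `k = 4`. In coordinates with `c = 1` (when `φ^† = φ` on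
  the nose) `τ : (p, t) ↦ (r p, 1 − t)` is an INVOLUTION, realised on the planar Kirby diagram of
  `X_F` (dotted verticals through the collinear holes, cycles on horizontal pages) by the rotation
  by `π` about the line of holes: `(X_F, τ)` is a cork candidate in the literal sense and
  `Σ = X_F ∪_τ X̄_F` is the cork twist of `S⁴ = D(X_F)`. For a Mazur cork presented by a symmetric
  2-component link with `τ` the swap, `C ∪_τ C̄ ≅ S⁴` (`τ(meridian of the 2-handle)` = meridian of
  the dotted circle cancels the 1-handle; the freed `0`-framed unknot gives `S² × D²`); whether
  every planar `(X_F, τ)` at `k = 4` untwists like this is the residual question of the layer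
  (prover target: "k = 4 ⇒ standard" = Gompf's Question 2.2 for reflection twists of planar
  Mazur-type corks inside their doubles; disprover target: a twin whose `τ` is not a link symmetry —
  none can be CERTIFIED exotic, §8). The first layer
  where non-twin inequivalent pairs can exist is `k = 5` (`Mod(D₄, ∂) ⊃ PB₄`, not a product of a
  free group with the centre); census v2 jobs j010358/j010359 (`k = 4`, pool cross-check) and
  j010363 (`k = 5`) are attached to the item when they end.
-/

/-- **The smallest reflection twin, as an identity in every group**:
`x · (x⁻¹y⁻¹x) y (x⁻¹y⁻¹x)⁻¹ = (y⁻¹xy)(x⁻¹yx)` — two splittings of `w = y⁻¹xyx⁻¹yx` as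
(conjugate of `x`)·(conjugate of `y`); in `PB₃/Z = ⟨T₁₂, T₂₃⟩ ≅ F₂` they are the images of the two
Hurwitz-inequivalent positive factorisations `t_{r₁₂} t_{β(r₂₃)} = t_{T₂₃⁻¹(r₁₂)} t_{T₁₂⁻¹(r₂₃)}`
of §7 (inequivalence: `y⁻¹xy ≠ wᵏxw⁻ᵏ`, a free-group length count). [folklore] -/
theorem twin_identity {G : Type*} [Group G] (x y : G) :
    x * ((x⁻¹ * y⁻¹ * x) * y * (x⁻¹ * y⁻¹ * x)⁻¹) = (y⁻¹ * x * y) * (x⁻¹ * y * x) := by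
  group

/-- The twin relation is the reflection symmetry: with `r(x) = x⁻¹`, `r(y) = y⁻¹`,
`w = y⁻¹xyx⁻¹yx` satisfies `r(w) = y w⁻¹ y⁻¹` (so `r(w) ∼ w⁻¹`), the condition under which the
second class exists (§7). [folklore] -/
theorem twin_identity' {G : Type*} [Group G] (x y : G) :
    (y⁻¹)⁻¹ * x⁻¹ * y⁻¹ * (x⁻¹)⁻¹ * y⁻¹ * x⁻¹ = y * (y⁻¹ * x * y * x⁻¹ * y * x)⁻¹ * y⁻¹ := by
  group

/-! ## §8 Targets: the picked line's stubs (`coloured-string-links-square-free-ac`)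

No stuck stubs are registered (payload `stuck_stubs = []`).  All four stubs of the picked line are
SHIELDED (no stub kill is possible short of an exotic `S⁴`): `stub_planarSeamTransfer` is LANDED
(p76418, true outright); `stub_planarSteinDoubleStandard` and `stub_nonSimplyConnectedHalves`
conclude `≅ S⁴` for a homotopy sphere / a double of a contractible (hence SPC4-implied, the latter
via crux 3546's `double_standard_of_crux`); and THE LEVER `stub_contractibleHalfDouble` (conclusion
`IsDouble (∂W₁) (𝓡 4) M`) follows from `SmoothPoincare4` together with crux 3546 — formal version
`stub_contractibleHalfDouble_of_spc4_of_crux3546` below: `M ≅ S⁴ ≅ D(W₁)` and doubles transport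
along diffeomorphisms (`isDouble_of_diffeomorph`).  (On paper crux 3546 is itself SPC4-implied —
`D(W₁)` is a homotopy sphere by van Kampen + Mayer–Vietoris — so the lever is SPC4-implied; the
tree lacks the Whitehead/Hurewicz recognition `π₁ = 1 ∧ H₂ = 0 ⇒ ≃ₕ S⁴` to say so formally.) -/

section Targets

variable {W : Type} [TopologicalSpace W] [ChartedSpace (EuclideanHalfSpace 4) W]

/-- **Doubles transport along diffeomorphisms of the ambient manifold.** [folklore] -/
theorem isDouble_of_diffeomorph (b : BoundaryData (𝓡∂ 4) W (𝓡 3)) {P Q : Type} [TopologicalSpace P]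
    [ChartedSpace 𝔼4 P] [IsManifold (𝓡 4) ∞ P] [TopologicalSpace Q] [ChartedSpace 𝔼4 Q]
    [IsManifold (𝓡 4) ∞ Q] (hD : IsDouble b (𝓡 4) P) (Φ : P ≃ₘ⟮𝓡 4, 𝓡 4⟯ Q) : IsDouble b (𝓡 4) Q := by
  obtain ⟨jA, jB, hA, hB, hU, hR⟩ := hD
  refine ⟨Φ ∘ jA, Φ ∘ jB, hA.diffeomorph_comp Φ, hB.diffeomorph_comp Φ, ?_, fun a a' => ?_⟩
  · rw [range_comp, range_comp, ← image_union, hU]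
    exact image_univ_of_surjective Φ.surjective
  · rw [comp_apply, comp_apply, ← hR a a']
    exact Φ.injective.eq_iff

/-- **THE LEVER IS SHIELDED modulo crux 3546**: `SmoothPoincare4 → ContractibleTwistedDoubleStandard →
stub_contractibleHalfDouble` (verbatim signature of the registered stub).  `M ≅ S⁴` by the summit;
the double `D(W₁)` exists (`exists_isBoundaryGluing_holds`) and is `≅ S⁴` by crux 3546
(`double_standard_of_crux`); transport.  So the line cannot be stranded on a FALSE lever — but
neither can the disprover break it. [folklore] -/
theorem stub_contractibleHalfDouble_of_spc4_of_crux3546 (hs : _root_.SmoothPoincare4)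
    (h3 : ContractibleTwistedDoubleStandard)
    (M : Type) [TopologicalSpace M] [T2Space M] [SecondCountableTopology M] [ChartedSpace 𝔼4 M]
    [IsManifold (𝓡 4) ∞ M] (hM : M ≃ₕ 𝕊⁴)
    (W₁ : Type) [TopologicalSpace W₁] [ChartedSpace (EuclideanHalfSpace 4) W₁] [IsManifold (𝓡∂ 4) ∞ W₁]
    [CompactSpace W₁] [ContractibleSpace W₁]
    (W₂ : Type) [TopologicalSpace W₂] [ChartedSpace (EuclideanHalfSpace 4) W₂] [IsManifold (𝓡∂ 4) ∞ W₂]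
    [CompactSpace W₂] (J₁ : SteinStructure W₁) (_J₂ : SteinStructure W₂) (e₁ : W₁ → M) (_e₂ : W₂ → M)
    (he₁ : Manifold.IsSmoothEmbedding (𝓡∂ 4) (𝓡 4) ∞ e₁)
    (_he₂ : Manifold.IsSmoothEmbedding (𝓡∂ 4) (𝓡 4) ∞ _e₂)
    (_hcover : range e₁ ∪ range _e₂ = univ)
    (_hseam₁ : range e₁ ∩ range _e₂ = e₁ '' (𝓡∂ 4).boundary W₁)
    (_hseam₂ : range e₁ ∩ range _e₂ = _e₂ '' (𝓡∂ 4).boundary W₂)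
    (_hξ : ∀ w₁ w₂, e₁ w₁ = _e₂ w₂ →
      Submodule.map (mfderiv (𝓡∂ 4) (𝓡 4) e₁ w₁).toLinearMap (contactPlane J₁.J w₁) =
      Submodule.map (mfderiv (𝓡∂ 4) (𝓡 4) _e₂ w₂).toLinearMap (contactPlane _J₂.J w₂))
    (_hpl : PlanarContactBoundary J₁) :
    IsDouble (BoundaryManifold.boundaryData 3 W₁) (𝓡 4) M := by
  haveI : T2Space W₁ := he₁.isEmbedding.t2Space
  haveI : SecondCountableTopology W₁ := he₁.isEmbedding.secondCountableTopology
  obtain ⟨ΦM⟩ := hs M ‹_› ‹_› hM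
  obtain ⟨P, _, _, _, _, _, _, hP⟩ :=
    exists_isBoundaryGluing_holds (bM := BoundaryManifold.boundaryData 3 W₁)
      (bN := BoundaryManifold.boundaryData 3 W₁) (Diffeomorph.refl (𝓡 3) _ ∞)
  have hD : IsDouble (BoundaryManifold.boundaryData 3 W₁) (𝓡 4) P := by
    have e : (⇑(Diffeomorph.refl (𝓡 3) (BoundaryManifold.boundaryData 3 W₁).carrier ∞) :
        (BoundaryManifold.boundaryData 3 W₁).carrier → (BoundaryManifold.boundaryData 3 W₁).carrier) = id :=
      rfl
    rw [e] at hP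
    exact hP
  obtain ⟨ΦP⟩ := double_standard_of_crux h3 W₁ J₁ (BoundaryManifold.boundaryData 3 W₁) P hD
  exact isDouble_of_diffeomorph _ hD (ΦP.trans ΦM.symm)

end Targets

end Summit.SmoothPoincare4.SmoothPoincare4.Cruxes.PlanarBisectionRigidity.Disproof
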